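/-
Copyright (c) 2026. All rights reserved.
Released under Apache 2.0 license as described in the file LICENSE.
-/
import Literature.MathematicalPhysics.QuantumFieldTheory.Balaban1983to89.B4Lemma22LpStair

/-!
# B4 Lemma 2.2 (2.17) OFF THE DIAGONAL FOR `G_k(□,Ã)` — THE PRINTED REDUCTION p. 581 TO THE ZERO-FIELD
PROPAGATOR, TYPED FOR PAIRS OF EXPONENTS (`L^p → L^q`, `L^p → L^∞`), AND THE PAIR DUALITIES FOR THE THIRD MEMBER

[B4] = T. Bałaban, *(Higgs)₂,₃ quantum fields in a finite volume. III. Regularity and decay of lattice Green's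
functions*, Commun. Math. Phys. **89** (1983) 571–597 (bib key `Balaban1983RegularityDecay`).

## The printed step («» = quotation units, transcript-B4.md ll. 106–108, 161–169, 187–192)

Lemma 2.2, pp. 577–578: «and a constant c₂ depending on d, p₁, such that (2.17) ‖G_k(□,Ã)f‖_q,
‖D^η_{Ã,μ}G_k(□,Ã)f‖_q, ‖G_k(□,Ã)D^{η*}_{Ã,μ}f‖_q ≤ c₂‖f‖_p for 1 ≤ p, q ≤ ∞, satisfying the condition
1/p − 1/p₁ ≤ 1/q ≤ 1/p with p₁ > d.»  Proof, p. 581: «Let us assume that Lemma 2.2 holds for G_k(□,A₀) with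
constant configurations A₀. We will prove it for a general case using (2.31).» … «Now using Lemma 2.2 for G_k(□,A₀)
and the decomposition D^η_Ã = U(A')D^η_{A₀} + F_{1,k}(A'), we have» (2.33) … «The series on the right hand side is
convergent for e sufficiently small, and we get the inequality (2.16). The inequality (2.17) is proved in the same
way.» «Lemma 2.2 in the case of a constant configuration A₀ is equivalent to the case of configuration A₀ = 0 by the
same argument with the gauge transformation as before. Thus we have reduced the proof of this lemma to a proof of
the» (p. 582) «corresponding properties for the propagator G_k(□,0), or to the one-component propagator G_k(□)
[G_k(□,0) = G_k(□)1, 1 is identity operator on R^N].»  And p. 583, for the third member: «For q = p = 1 we get it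
by duality argument, i.e. using the fact that the space L^∞(□) is adjoint to L¹(□).» … «Again by the duality
argument we get that the operator G_k(□) and its first order derivatives are bounded operators from L¹(□) to
L^{p'₁}(□), p'₁^{−1} + p₁^{−1} = 1.»

## What this file proves (0 sorry; 0 cited facts; all theorems from the lineage's definitions and Mathlib)

The lineage has (2.17) for [B4]'s `G_k(□,Ã)` (`B4Lemma22ReduceZero.greenA`, `Ã = A₀ + A'`) on boxes with all
three members `n ≤ 1` on the whole DIAGONAL `q = p ∈ [1,∞]` (`B4Lemma22SupStair`, `B4Lemma22DualL1`,
`B4Lemma22L1Stair`, `B4Lemma22LpStair`).  OFF the diagonal the printed proof is the SAME reduction (2.31)–(2.33) —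
the perturbation series is controlled in the SOURCE norm `‖·‖_p` (where `V_k` is first-order small and
`G_k(□,A₀)` is bounded: the diagonal row, in the tree) and the TARGET norm is read off the constant-field
propagator — followed by the gauge step `A₀ ↦ 0`.  This file TYPES that reduction for PAIRS of exponents, with the
zero-field pair bound as an EXPLICIT HYPOTHESIS (free constant `C ≥ 0`; in [B4] it is supplied by (2.34)–(2.41) and
Riesz–Thorin for the one-component `G_k(□)`, and in the counting-measure normalisation used here it carries the
factor `η^{(d+1)(1/p − 1/q)}`):
* §1 pair dualities for the mixed norms `‖·‖_p = B4Lemma22LpStair.lpM p`, `‖·‖_∞ = supN`, `‖·‖₁ = l1N`: Hölder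
  `⟨Φ,Ψ⟩ ≤ ‖Φ‖_p‖Ψ‖_{p'}` (`dot_le_lpM_mul`), the `L^q` dual witness (`dual_witness`, `lpM_le_of_dual`), and the four
  transposition rules `‖T‖_{q'→p'} ≤ B ⇒ ‖Tᵀ‖_{p→q} ≤ B` (`lpM_transpose_le_pq`, `1 < p, q < ∞`), `‖T‖_{q'→∞} ≤ B ⇒
  ‖Tᵀ‖_{1→q} ≤ B` (`lpM_transpose_le_of_sup`), `‖T‖_{1→p'} ≤ B ⇒ ‖Tᵀ‖_{p→∞} ≤ B` (`supN_transpose_le_of_lp`),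
  `‖T‖_{1→∞} ≤ B ⇒ ‖Tᵀ‖_{1→∞} ≤ B` (`supN_transpose_le_of_sup`);
* §2 the abstract engine for pairs: the gauge step with two functionals (`hyps_conj₂`), the (2.33) transfer for
  the DERIVATIVE member `N(D_μGΦ) ≤ 2c₁νΦ` (`transfer_deriv`, next to `B4Lemma22Reduce231.transfer`), and the
  scalar-kernel lifts `lpM_kron_le_pq` / `supN_kron_le_p` (`|S| : ℓ^p → ℓ^q` on nonnegative scalar functions ⇒
  `S⊗1` on `N`-component fields);
* §3 `lemma22_17_transfer_box`: on a fine box, under EXACTLY the hypotheses of `B4Lemma22LpStair.lemma22_17_lp_box`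
  (invertibility of `H_k(□,Ã)`, the (2.23)-type bounds `θ, θ', τ`, `A' = 0` near the `μ`-faces, the smallness
  inequality), for every source exponent `p ≥ 1` and every subadditive, gauge-invariant target functional `N` with
  `N((D_Ã − D_{A₀})u) ≤ ℓθ·N(u)`: IF `N((G_k(□)⊗1)Φ) ≤ C‖Φ‖_p` and `N((D^η_μ⊗1)(G_k(□)⊗1)Φ) ≤ C‖Φ‖_p` THEN
  `N(Gf) ≤ 2C‖f‖_p`, `N(D^η_{A₀,μ}Gf) ≤ 2C‖f‖_p`, `N(D^η_{Ã,μ}Gf) ≤ (1+ℓθ)2C‖f‖_p` (`G = G_k(□,Ã)`, every constant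
  `A₀`); instances `lemma22_17_pq_box` (`N = ‖·‖_q`, any real `q ≥ 1`) and `lemma22_17_psup_box` (`N = ‖·‖_∞`);
* §4 the THIRD member `G D^{η*}_μ` at the pair `(p,q)` from the zero-field pair bound at the DUAL pair `(q',p')`
  (`Gᵀ = G`): `lemma22_17_pq_box_dual` (`1 < p, q < ∞`), `lemma22_17_pq_box_dual_one` (`p = 1 < q < ∞`),
  `lemma22_17_pq_box_dual_sup` (`1 < p < q = ∞`), `lemma22_17_pq_box_dual_one_sup` (`p = 1`, `q = ∞`);
* §5 `lemma22_17_pq_stair`: the staircase specialisation of `lemma22_17_pq_box` (invertibility, contour ends,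
  `τ = (d+1)θ` discharged as in `B4Lemma22LpStair.lemma22_17_lp_stair`);
* §6 the dictionary to the b04 carrier functional `B4Lemma21Region.RegularCubeInstance.lpN` (`η`-weighted,
  reciprocal exponent): `lpN s f = (η^{d+1})^s · ‖f‖_{1/s}` for `s ≠ 0` and `lpN 0 f = ‖f‖_∞`.

## Honest scope

(a) A REDUCTION: the zero-field pair bounds are HYPOTHESES with a free constant (this file does not prove (2.17)
off the diagonal for `G_k(□)`; the sibling `B4Lemma22ZeroBoxLpLq` of another seat treats the zero-field
propagator in its own typing, and no bridge between the typings is claimed here).  (b) Boxes `Π[0,(ℓ+1)^kM_μ)` with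
an arbitrary contour system ending at the averaged point (§5: the staircase contours of the lineage); no torus, no
general region.  (c) (2.23)-TYPE hypotheses with free
`θ, θ', τ` and explicit smallness; their provenance from (1.7) is not certified.  (d) Members `n ≤ 1` only; (2.16)
untouched.  (e) DIVERGENCE from the print: none in the reduction itself (it is (2.31)–(2.33) verbatim with `ν =
‖·‖_p`); for the third member explicit `L^p`-dual witnesses are used where the print says «by the duality
argument».  (f) Constants explicit (`2C`, `(1+ℓθ)2C`), not optimised.  (g) Value = kernel certificate of printed
inference steps, NOT summit progress.  No manuscript step is used as a hypothesis of a theorem claiming a printed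
conclusion unconditionally: the zero-field input enters as an explicit, clearly named binder.
-/

namespace Literature.MathematicalPhysics.QuantumFieldTheory.Balaban1983to89.B4Lemma22LpLqTransfer

open Finset Matrix
open scoped Kronecker
open Literature.MathematicalPhysics.QuantumFieldTheory.Balaban1983to89.B4GaugeCovariance
open Literature.MathematicalPhysics.QuantumFieldTheory.Balaban1983to89.B4Lower18Regular (e1 kmul kmul_apply pertE
  pertT crossOp quadOp pertF vOp lsum sum_blkWt_row sum_blkWt_col baseEmb stairContour stairContour_end
  green_box_l2_bound)
open Literature.MathematicalPhysics.QuantumFieldTheory.Balaban1983to89.B4Lower18 (fineDom)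
open Literature.MathematicalPhysics.QuantumFieldTheory.Balaban1983to89.B4Lemma21Region (siteNorm covDeriv
  RegularCubeInstance)
open Literature.MathematicalPhysics.QuantumFieldTheory.Balaban1983to89.B4Reflection242 (nbrs boxDom nbrs_comm)
open Literature.MathematicalPhysics.QuantumFieldTheory.Balaban1983to89.B4BoxCov237 (boxOpR_det_isUnit)
open Literature.MathematicalPhysics.QuantumFieldTheory.Balaban1983to89.B4Lemma22Reduce231
open Literature.MathematicalPhysics.QuantumFieldTheory.Balaban1983to89.B4Lemma22ReduceZero
open Literature.MathematicalPhysics.QuantumFieldTheory.Balaban1983to89.B4Lemma22ReduceDeriv (siteNorm_flow_sub_one_le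
  siteNorm_flow add_e1_mem_nbrs covDeriv_sub_fld_of_mem covDeriv_sub_fld_of_not_mem covDeriv_sub_supN_le)
open Literature.MathematicalPhysics.QuantumFieldTheory.Balaban1983to89.B4Lemma22PertVSup (siteNorm_neg
  constBond_antisymm)
open Literature.MathematicalPhysics.QuantumFieldTheory.Balaban1983to89.B4Lemma22SupStair (stair_lsum_le)
open Literature.MathematicalPhysics.QuantumFieldTheory.Balaban1983to89.B4Lemma22ConstRows (siteW fld_siteW_self
  fld_siteW_ne siteW_dot l1N_siteW_le)
open Literature.MathematicalPhysics.QuantumFieldTheory.Balaban1983to89.B4Lemma22DualL1 (b4Green_transpose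
  dotProduct_eq_sum_fld dot_le_siteNorm_mul l1N_transpose_le)
open Literature.MathematicalPhysics.QuantumFieldTheory.Balaban1983to89.B4Lemma22L1Stair
open Literature.MathematicalPhysics.QuantumFieldTheory.Balaban1983to89.B4Lemma22LpStair

noncomputable section

variable {ι : Type} [Fintype ι] [DecidableEq ι]

/-! ## §1 Pair dualities for the mixed norms `‖·‖_p`, `‖·‖_∞`, `‖·‖₁` -/

section Mixed

variable {X : Type*} [Fintype X]

omit [DecidableEq ι] in
/-- **HÖLDER FOR THE MIXED NORMS**: `⟨Φ,Ψ⟩ ≤ ‖Φ‖_p‖Ψ‖_{p'}` (`1/p + 1/p' = 1`, `1 < p < ∞`) — Cauchy–Schwarz per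
site, then Mathlib's `Real.inner_le_Lp_mul_Lq` over the sites. [folklore] -/
theorem dot_le_lpM_mul {p p' : ℝ} (hp : p.HolderConjugate p') (Φ Ψ : X × ι → ℝ) :
    Φ ⬝ᵥ Ψ ≤ lpM p Φ * lpM p' Ψ :=
  calc Φ ⬝ᵥ Ψ = ∑ x, fld Φ x ⬝ᵥ fld Ψ x := dotProduct_eq_sum_fld _ _
    _ ≤ ∑ x, siteNorm (fld Φ x) * siteNorm (fld Ψ x) := sum_le_sum fun x _ => dot_le_siteNorm_mul _ _
    _ ≤ (∑ x, |siteNorm (fld Φ x)| ^ p) ^ (1 / p) * (∑ x, |siteNorm (fld Ψ x)| ^ p') ^ (1 / p') :=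
        Real.inner_le_Lp_mul_Lq univ _ _ hp
    _ = lpM p Φ * lpM p' Ψ := by rw [one_div, one_div]; rfl

omit [DecidableEq ι] in
/-- **THE `L^q` DUAL WITNESS** `Φ(x) = |ψ(x)|^{q−2}ψ(x)` of a field `Ψ` (`1 < q < ∞`, `1/q + 1/q' = 1`):
`⟨Ψ,Φ⟩ = Σ_x|ψ(x)|^q` and `‖Φ‖_{q'} = (Σ_x|ψ(x)|^q)^{1/q'}`. [folklore] -/
theorem dual_witness {q q' : ℝ} (hq : q.HolderConjugate q') (Ψ : X × ι → ℝ) :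
    ∃ Φ : X × ι → ℝ, Ψ ⬝ᵥ Φ = ∑ x, siteNorm (fld Ψ x) ^ q ∧
      lpM q' Φ = (∑ x, siteNorm (fld Ψ x) ^ q) ^ q'⁻¹ := by
  have hq1 : 1 < q := hq.lt
  have hq0 : 0 < q := hq.pos
  set Φ : X × ι → ℝ := fun z => siteNorm (fld Ψ z.1) ^ (q - 2) * Ψ z with hΦ
  have hfldΦ : ∀ x, fld Φ x = (siteNorm (fld Ψ x) ^ (q - 2)) • fld Ψ x := fun x => by
    ext i; simp only [fld_apply, hΦ, Pi.smul_apply, smul_eq_mul]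
  have hsΦ : ∀ x, siteNorm (fld Φ x) = siteNorm (fld Ψ x) ^ (q - 1) := by
    intro x
    rw [hfldΦ, siteNorm_smul, abs_of_nonneg (Real.rpow_nonneg (siteNorm_nonneg _) _)]
    by_cases h0 : siteNorm (fld Ψ x) = 0
    · rw [h0, mul_zero, Real.zero_rpow (by linarith)]
    · rw [← Real.rpow_add_one h0, show q - 2 + 1 = q - 1 by ring]
  refine ⟨Φ, ?_, ?_⟩
  · rw [dotProduct_eq_sum_fld]
    refine sum_congr rfl fun x _ => ?_
    rw [hfldΦ, dotProduct_smul, smul_eq_mul]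
    have h00 : 0 ≤ fld Ψ x ⬝ᵥ fld Ψ x := Finset.sum_nonneg fun i _ => mul_self_nonneg _
    have hsq : fld Ψ x ⬝ᵥ fld Ψ x = siteNorm (fld Ψ x) ^ (2 : ℝ) := by
      rw [Real.rpow_two]
      unfold siteNorm
      rw [Real.sq_sqrt h00]
    rw [hsq]
    by_cases h0 : siteNorm (fld Ψ x) = 0
    · rw [h0, Real.zero_rpow two_ne_zero, mul_zero, Real.zero_rpow hq0.ne']
    · rw [← Real.rpow_add (lt_of_le_of_ne (siteNorm_nonneg _) (Ne.symm h0)), show q - 2 + 2 = q by ring]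
  · unfold lpM lpS
    congr 1
    refine sum_congr rfl fun x _ => ?_
    rw [abs_of_nonneg (siteNorm_nonneg _), hsΦ, ← Real.rpow_mul (siteNorm_nonneg _), hq.sub_one_mul_conj]

omit [DecidableEq ι] in
/-- from `Σ|ψ|^q ≤ A·(Σ|ψ|^q)^{1/q'}` to `‖Ψ‖_q ≤ A` (`1/q = 1 − 1/q'`). [folklore] -/
theorem lpM_le_of_dual {q q' : ℝ} (hq : q.HolderConjugate q') {Ψ : X × ι → ℝ} {A : ℝ} (hA : 0 ≤ A)
    (h : ∑ x, siteNorm (fld Ψ x) ^ q ≤ A * (∑ x, siteNorm (fld Ψ x) ^ q) ^ q'⁻¹) : lpM q Ψ ≤ A := by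
  have hq0 : 0 < q := hq.pos
  set S : ℝ := ∑ x, siteNorm (fld Ψ x) ^ q with hS
  have hS0 : 0 ≤ S := sum_nonneg fun x _ => Real.rpow_nonneg (siteNorm_nonneg _) _
  have hΨq : lpM q Ψ = S ^ q⁻¹ := by
    unfold lpM lpS
    congr 1
    exact sum_congr rfl fun x _ => by rw [abs_of_nonneg (siteNorm_nonneg _)]
  rw [hΨq]
  by_cases hS1 : S = 0
  · rw [hS1, Real.zero_rpow (inv_ne_zero hq0.ne')]
    exact hA
  have hSpos : 0 < S := lt_of_le_of_ne hS0 (Ne.symm hS1)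
  have hSq : 0 < S ^ q'⁻¹ := Real.rpow_pos_of_pos hSpos _
  have key : S * (S ^ q'⁻¹)⁻¹ ≤ A := by
    rw [mul_inv_le_iff₀ hSq]
    exact h
  have e2 : S * (S ^ q'⁻¹)⁻¹ = S ^ q⁻¹ := by
    have hq' : q⁻¹ = 1 + -q'⁻¹ := by linarith [hq.inv_add_inv_eq_one]
    rw [← Real.rpow_neg hS0, hq', Real.rpow_add hSpos, Real.rpow_one]
  rw [← e2]
  exact key

omit [DecidableEq ι] in
/-- **PAIR DUALITY** (`1 < p, q < ∞`, conjugates `p', q'`): `‖TΦ‖_{p'} ≤ B‖Φ‖_{q'}` for all `Φ` gives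
`‖Tᵀg‖_q ≤ B‖g‖_p` for all `g` — `Σ|ψ|^q = ⟨Tᵀg,Φ⟩ = ⟨g,TΦ⟩ ≤ ‖g‖_p‖TΦ‖_{p'} ≤ B‖g‖_p(Σ|ψ|^q)^{1/q'}` with the dual
witness `Φ` of `Ψ = Tᵀg` («by duality argument»; the `L^{q'}`/`L^q` and `L^p`/`L^{p'}` pairings). [folklore] -/
theorem lpM_transpose_le_pq {p p' q q' : ℝ} (hp : p.HolderConjugate p') (hq : q.HolderConjugate q')
    {T : Matrix (X × ι) (X × ι) ℝ} {B : ℝ} (hB : 0 ≤ B) (h : ∀ Φ, lpM p' (T *ᵥ Φ) ≤ B * lpM q' Φ)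
    (g : X × ι → ℝ) : lpM q (Tᵀ *ᵥ g) ≤ B * lpM p g := by
  obtain ⟨Φ, hdot, hΦq⟩ := dual_witness hq (Tᵀ *ᵥ g)
  refine lpM_le_of_dual hq (mul_nonneg hB (lpM_nonneg _ _)) ?_
  have e1 : ∑ x, siteNorm (fld (Tᵀ *ᵥ g) x) ^ q = g ⬝ᵥ (T *ᵥ Φ) := by
    rw [← hdot, Matrix.mulVec_transpose, Matrix.dotProduct_mulVec]
  calc ∑ x, siteNorm (fld (Tᵀ *ᵥ g) x) ^ q = g ⬝ᵥ (T *ᵥ Φ) := e1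
    _ ≤ lpM p g * lpM p' (T *ᵥ Φ) := dot_le_lpM_mul hp _ _
    _ ≤ lpM p g * (B * lpM q' Φ) := mul_le_mul_of_nonneg_left (h Φ) (lpM_nonneg _ _)
    _ = B * lpM p g * (∑ x, siteNorm (fld (Tᵀ *ᵥ g) x) ^ q) ^ q'⁻¹ := by rw [hΦq]; ring

omit [DecidableEq ι] in
/-- **PAIR DUALITY, SOURCE `p = 1`** (`1 < q < ∞`): `‖TΦ‖_∞ ≤ B‖Φ‖_{q'}` for all `Φ` gives `‖Tᵀg‖_q ≤ B‖g‖₁` —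
the `L^∞`/`L¹` pairing `⟨g,TΦ⟩ ≤ ‖TΦ‖_∞‖g‖₁` («using the fact that the space L^∞(□) is adjoint to L¹(□)»).
[folklore] -/
theorem lpM_transpose_le_of_sup {q q' : ℝ} (hq : q.HolderConjugate q') {T : Matrix (X × ι) (X × ι) ℝ} {B : ℝ}
    (hB : 0 ≤ B) (h : ∀ Φ, supN (T *ᵥ Φ) ≤ B * lpM q' Φ) (g : X × ι → ℝ) :
    lpM q (Tᵀ *ᵥ g) ≤ B * l1N g := by
  obtain ⟨Φ, hdot, hΦq⟩ := dual_witness hq (Tᵀ *ᵥ g)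
  refine lpM_le_of_dual hq (mul_nonneg hB (l1N_nonneg _)) ?_
  have e1 : ∑ x, siteNorm (fld (Tᵀ *ᵥ g) x) ^ q = (T *ᵥ Φ) ⬝ᵥ g := by
    rw [← hdot, Matrix.mulVec_transpose, ← Matrix.dotProduct_mulVec, dotProduct_comm]
  calc ∑ x, siteNorm (fld (Tᵀ *ᵥ g) x) ^ q = (T *ᵥ Φ) ⬝ᵥ g := e1
    _ ≤ |(T *ᵥ Φ) ⬝ᵥ g| := le_abs_self _
    _ ≤ supN (T *ᵥ Φ) * l1N g := abs_dotProduct_le_supN_mul_l1N _ _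
    _ ≤ B * lpM q' Φ * l1N g := mul_le_mul_of_nonneg_right (h Φ) (l1N_nonneg _)
    _ = B * l1N g * (∑ x, siteNorm (fld (Tᵀ *ᵥ g) x) ^ q) ^ q'⁻¹ := by rw [hΦq]; ring

omit [DecidableEq ι] in
/-- **PAIR DUALITY, TARGET `q = ∞`** (`1 < p < ∞`): `‖TΦ‖_{p'} ≤ B‖Φ‖₁` for all `Φ` gives `‖Tᵀg‖_∞ ≤ B‖g‖_p` —
test `Tᵀg` at a site against the single-site unit field `B4Lemma22ConstRows.siteW` (`‖siteW‖₁ ≤ 1`). [folklore] -/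
theorem supN_transpose_le_of_lp [DecidableEq X] {p p' : ℝ} (hp : p.HolderConjugate p')
    {T : Matrix (X × ι) (X × ι) ℝ} {B : ℝ} (hB : 0 ≤ B) (h : ∀ Φ, lpM p' (T *ᵥ Φ) ≤ B * l1N Φ)
    (g : X × ι → ℝ) : supN (Tᵀ *ᵥ g) ≤ B * lpM p g := by
  refine supN_le (mul_nonneg hB (lpM_nonneg _ _)) fun x => ?_
  have h1 : siteNorm (fld (Tᵀ *ᵥ g) x) = g ⬝ᵥ (T *ᵥ siteW (Tᵀ *ᵥ g) x) := by
    rw [← siteW_dot (Tᵀ *ᵥ g) x, Matrix.dotProduct_mulVec, Matrix.vecMul_transpose, dotProduct_comm]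
  rw [h1]
  calc g ⬝ᵥ (T *ᵥ siteW (Tᵀ *ᵥ g) x) ≤ lpM p g * lpM p' (T *ᵥ siteW (Tᵀ *ᵥ g) x) := dot_le_lpM_mul hp _ _
    _ ≤ lpM p g * (B * l1N (siteW (Tᵀ *ᵥ g) x)) := mul_le_mul_of_nonneg_left (h _) (lpM_nonneg _ _)
    _ ≤ lpM p g * (B * 1) :=
        mul_le_mul_of_nonneg_left (mul_le_mul_of_nonneg_left (l1N_siteW_le _ _) hB) (lpM_nonneg _ _)
    _ = B * lpM p g := by ring

omit [DecidableEq ι] in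
/-- **PAIR DUALITY, `p = 1`, `q = ∞`**: `‖TΦ‖_∞ ≤ B‖Φ‖₁` for all `Φ` gives `‖Tᵀg‖_∞ ≤ B‖g‖₁`. [folklore] -/
theorem supN_transpose_le_of_sup [DecidableEq X] {T : Matrix (X × ι) (X × ι) ℝ} {B : ℝ} (hB : 0 ≤ B)
    (h : ∀ Φ, supN (T *ᵥ Φ) ≤ B * l1N Φ) (g : X × ι → ℝ) : supN (Tᵀ *ᵥ g) ≤ B * l1N g := by
  refine supN_le (mul_nonneg hB (l1N_nonneg _)) fun x => ?_
  have h1 : siteNorm (fld (Tᵀ *ᵥ g) x) = (T *ᵥ siteW (Tᵀ *ᵥ g) x) ⬝ᵥ g := by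
    rw [← siteW_dot (Tᵀ *ᵥ g) x, Matrix.dotProduct_mulVec, Matrix.vecMul_transpose]
  rw [h1]
  calc (T *ᵥ siteW (Tᵀ *ᵥ g) x) ⬝ᵥ g ≤ |(T *ᵥ siteW (Tᵀ *ᵥ g) x) ⬝ᵥ g| := le_abs_self _
    _ ≤ supN (T *ᵥ siteW (Tᵀ *ᵥ g) x) * l1N g := abs_dotProduct_le_supN_mul_l1N _ _
    _ ≤ B * l1N (siteW (Tᵀ *ᵥ g) x) * l1N g := mul_le_mul_of_nonneg_right (h _) (l1N_nonneg _)
    _ ≤ B * 1 * l1N g :=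
        mul_le_mul_of_nonneg_right (mul_le_mul_of_nonneg_left (l1N_siteW_le _ _) hB) (l1N_nonneg _)
    _ = B * l1N g := by ring

/-- **SCALAR-KERNEL LIFT FOR A PAIR OF EXPONENTS**: if the ABSOLUTE kernel `|S|` maps nonnegative scalar functions
`ℓ^p → ℓ^q` with constant `C`, then `S⊗1` maps `N`-component fields `‖·‖_p → ‖·‖_q` with constant `C`
(`|((S⊗1)Φ)(y)| ≤ Σ_x|S(y,x)||φ(x)|`). («or to the one-component propagator G_k(□) [G_k(□,0) = G_k(□)1, 1 is
identity operator on R^N]») [folklore] -/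
theorem lpM_kron_le_pq {Y : Type*} [Fintype Y] {p q : ℝ} (hq : 0 < q) {S : Matrix Y X ℝ} {C : ℝ}
    (hS : ∀ ψ : X → ℝ, (∀ x, 0 ≤ ψ x) → lpS q (fun y => ∑ x, |S y x| * ψ x) ≤ C * lpS p ψ)
    (Φ : X × ι → ℝ) : lpM q ((S ⊗ₖ (1 : Matrix ι ι ℝ)) *ᵥ Φ) ≤ C * lpM p Φ := by
  unfold lpM
  exact (lpS_mono' hq (fun _ => siteNorm_nonneg _) (siteNorm_kron_row_le S Φ)).trans
    (hS _ fun _ => siteNorm_nonneg _)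

/-- the scalar-kernel lift with target `‖·‖_∞`: a sitewise bound `Σ_x|S(y,x)|ψ(x) ≤ C‖ψ‖_p` on nonnegative `ψ`
gives `‖(S⊗1)Φ‖_∞ ≤ C‖Φ‖_p`. [folklore] -/
theorem supN_kron_le_p {Y : Type*} [Fintype Y] {p : ℝ} {S : Matrix Y X ℝ} {C : ℝ} (hC : 0 ≤ C)
    (hS : ∀ ψ : X → ℝ, (∀ x, 0 ≤ ψ x) → ∀ y, ∑ x, |S y x| * ψ x ≤ C * lpS p ψ) (Φ : X × ι → ℝ) :
    supN ((S ⊗ₖ (1 : Matrix ι ι ℝ)) *ᵥ Φ) ≤ C * lpM p Φ :=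
  supN_le (mul_nonneg hC (lpM_nonneg _ _)) fun y =>
    (siteNorm_kron_row_le S Φ y).trans (hS _ (fun _ => siteNorm_nonneg _) y)

end Mixed

/-! ## §2 The abstract engine for pairs: gauge step with two functionals, transfer for the derivative member -/

section Abstract

variable {X : Type*} [Fintype X] [DecidableEq X]

/-- **THE GAUGE STEP FOR A PAIR OF FUNCTIONALS** («by the same argument with the gauge transformation as before»):
if the target functional `N` is invariant under `𝒢` and the source functional `ν` under `𝒢ᵀ`, then the bounds
`N(G₀Φ) ≤ CνΦ`, `N(D_μG₀Φ) ≤ CνΦ` pass to the conjugated operators `𝒢G₀𝒢ᵀ`, `𝒢D_μ𝒢ᵀ` with the same constant.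
[cite: Balaban1983RegularityDecay, p. 581] -/
theorem hyps_conj₂ {K : Type*} {ν N : (X × ι → ℝ) → ℝ} {g : X → Matrix ι ι ℝ}
    (hN : ∀ Φ, N (blockDiag g *ᵥ Φ) = N Φ) (hνt : ∀ Φ, ν ((blockDiag g)ᵀ *ᵥ Φ) = ν Φ) (hg : IsGauge g)
    {G₀ : Matrix (X × ι) (X × ι) ℝ} {D : K → Matrix (X × ι) (X × ι) ℝ} {C : ℝ}
    (h0 : ∀ Φ, N (G₀ *ᵥ Φ) ≤ C * ν Φ) (hD : ∀ μ Φ, N (D μ *ᵥ (G₀ *ᵥ Φ)) ≤ C * ν Φ) :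
    (∀ Φ, N ((blockDiag g * G₀ * (blockDiag g)ᵀ) *ᵥ Φ) ≤ C * ν Φ) ∧
    (∀ μ Φ, N ((blockDiag g * D μ * (blockDiag g)ᵀ) *ᵥ ((blockDiag g * G₀ * (blockDiag g)ᵀ) *ᵥ Φ))
        ≤ C * ν Φ) := by
  refine ⟨fun Φ => ?_, fun μ Φ => ?_⟩
  · rw [← mulVec_mulVec, ← mulVec_mulVec, hN]
    simpa only [hνt] using h0 ((blockDiag g)ᵀ *ᵥ Φ)
  · rw [mulVec_mulVec, conj_mul_conj hg, ← mulVec_mulVec, ← mulVec_mulVec, ← mulVec_mulVec, hN]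
    simpa only [hνt] using hD μ ((blockDiag g)ᵀ *ᵥ Φ)

variable {κ : Type*} [Fintype κ] {ν : (X × ι → ℝ) → ℝ}

omit [DecidableEq X] [DecidableEq ι] in
/-- **(2.33) TRANSFER FOR THE DERIVATIVE MEMBER**: under the hypotheses of `B4Lemma22Reduce231.bootstrap` in the
source functional `ν`, a subadditive `N` with `N(D_μG₀Φ) ≤ c₁νΦ` satisfies `N(D_μGΦ) ≤ 2c₁νΦ`
(`D_μGΦ = D_μG₀Φ + D_μG₀(VGΦ)` and `ν(VGΦ) ≤ νΦ`, `B4Lemma22Reduce231.bootstrap_pert`).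
[cite: Balaban1983RegularityDecay, p. 581 (2.31)–(2.33)] -/
theorem transfer_deriv (hν0 : ∀ a, 0 ≤ ν a) (hνadd : ∀ a b, ν (a + b) ≤ ν a + ν b)
    {G G₀ V : Matrix (X × ι) (X × ι) ℝ} {D : κ → Matrix (X × ι) (X × ι) ℝ} {c ε : ℝ}
    (hres : G = G₀ + G₀ * V * G) (hc : 0 ≤ c) (hε : 0 ≤ ε)
    (h0 : ∀ Φ, ν (G₀ *ᵥ Φ) ≤ c * ν Φ) (hD : ∀ μ Φ, ν (D μ *ᵥ (G₀ *ᵥ Φ)) ≤ c * ν Φ)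
    (hV : FirstOrderSmall ν V D ε) (hsm : (Fintype.card κ + 1) * c * ε ≤ 1 / 2)
    {N : (X × ι → ℝ) → ℝ} (hNadd : ∀ a b, N (a + b) ≤ N a + N b) {c₁ : ℝ} (hc₁ : 0 ≤ c₁) {μ : κ}
    (hN : ∀ Φ, N (D μ *ᵥ (G₀ *ᵥ Φ)) ≤ c₁ * ν Φ) (Φ : X × ι → ℝ) :
    N (D μ *ᵥ (G *ᵥ Φ)) ≤ 2 * c₁ * ν Φ := by
  have hp := bootstrap_pert hν0 hνadd hres hc hε h0 hD hV hsm Φ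
  calc N (D μ *ᵥ (G *ᵥ Φ)) = N (D μ *ᵥ (G₀ *ᵥ Φ) + D μ *ᵥ (G₀ *ᵥ (V *ᵥ (G *ᵥ Φ)))) := by
        rw [← mulVec_add, ← resolvent_mulVec hres]
    _ ≤ N (D μ *ᵥ (G₀ *ᵥ Φ)) + N (D μ *ᵥ (G₀ *ᵥ (V *ᵥ (G *ᵥ Φ)))) := hNadd _ _
    _ ≤ c₁ * ν Φ + c₁ * ν (V *ᵥ (G *ᵥ Φ)) := add_le_add (hN _) (hN _)
    _ ≤ c₁ * ν Φ + c₁ * ν Φ := add_le_add le_rfl (mul_le_mul_of_nonneg_left hp hc₁)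
    _ = 2 * c₁ * ν Φ := by ring

end Abstract

/-! ## §3 THE REDUCTION (2.31)–(2.33) FOR A PAIR (SOURCE `‖·‖_p`, TARGET `N`) FOR `G_k(□,Ã)` ON A BOX -/

section Transfer

variable {d : ℕ}

/-- **THE p. 581 REDUCTION OF (2.17) FOR `G_k(□,Ã)`, `Ã = A₀ + A'`, TO THE ZERO-FIELD PROPAGATOR, FOR A PAIR (SOURCE
`‖·‖_p`, ABSTRACT TARGET `N`)** — «Let us assume that Lemma 2.2 holds for G_k(□,A₀) with constant configurations
A₀. We will prove it for a general case using (2.31).» … «Lemma 2.2 in the case of a constant configuration A₀ is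
equivalent to the case of configuration A₀ = 0 by the same argument with the gauge transformation as before.»:
there is `c > 0` (the DIAGONAL constant of `B4Lemma22LpStair.const_box_lp`, uniform on the window, all `k ≥ 1`, all
boxes, all contour systems ending at the averaged point, all `A₀`, all `p`) such that under EXACTLY the hypotheses
of `B4Lemma22LpStair.lemma22_17_lp_box` (invertibility of `H_k(□,Ã)`, `|κA'_b| ≤ θ/n`, `|κ(A'(b') − A'(b))| ≤ θ'/n²`,
`A' = 0` on the `μ`-bonds touching the `μ`-faces, `|κA'(Γ_{y,x})| ≤ τ`, `(d+2)c(…) ≤ 1/2`), for every `p ≥ 1`, every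
target functional `N` which is subadditive, invariant under gauge transformations and satisfies the conversion bound
`N((D^η_{Ã,μ} − D^η_{A₀,μ})u) ≤ ℓθN(u)`, and every `C ≥ 0`: IF the ZERO-FIELD propagator obeys
`N((G_k(□)⊗1)Φ) ≤ C‖Φ‖_p` and `N((D^η_μ⊗1)(G_k(□)⊗1)Φ) ≤ C‖Φ‖_p` for all `Φ, μ`, THEN for every `f`:
`N(Gf) ≤ 2C‖f‖_p`, `N(D^η_{A₀,μ}Gf) ≤ 2C‖f‖_p` and `N(D^η_{Ã,μ}Gf) ≤ (1+ℓθ)2C‖f‖_p`, `G = G_k(□,Ã)`.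
(Source side: the `‖·‖_p` bootstrap hypotheses — `G_k(□,A₀)` bounded, `V_k` first-order small — are the diagonal row
of `B4Lemma22LpStair`; target side: (2.33) `B4Lemma22Reduce231.transfer` / `transfer_deriv`; gauge step `hyps_conj₂`.)
[cite: Balaban1983RegularityDecay, Lemma 2.2 (2.17) p. 578; proof p. 581 (2.31)–(2.33); p. 582] -/
theorem lemma22_17_transfer_box (F : OrthFlow ι) {ℓ₁ : ℝ} (hℓ₁ : 0 ≤ ℓ₁)
    (hLip : ∀ t (v : ι → ℝ), ((F.U t - 1) *ᵥ v) ⬝ᵥ ((F.U t - 1) *ᵥ v) ≤ (ℓ₁ * t) ^ 2 * (v ⬝ᵥ v))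
    (κ : ℝ) (d ℓ : ℕ) (hℓ : 1 ≤ ℓ) (amin aplus m2plus : ℝ) (ha : 0 < amin) :
    ∃ c : ℝ, 0 < c ∧ ∀ (k : ℕ), 1 ≤ k → ∀ (a m2 : ℝ), amin ≤ a → a ≤ aplus → 0 ≤ m2 → m2 ≤ m2plus →
      ∀ (M : Fin (d + 1) → ℕ), (∀ i, 1 ≤ M i) →
      ∀ (emb : ↥(boxDom M) → ↥(Box d ℓ k M)) (Γ : ↥(boxDom M) → ↥(Box d ℓ k M) → List ↥(Box d ℓ k M)),
        (∀ y x, blkWt ((ℓ + 1) ^ k) M (fun i => (ℓ + 1) ^ k * M i) y x ≠ 0 → pathEnd (emb y) (Γ y x) = x) →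
      ∀ (A₀ : Fin (d + 1) → ℝ) (A' : ↥(Box d ℓ k M) → ↥(Box d ℓ k M) → ℝ) (θ θ' τ : ℝ),
        IsUnit (opA d F κ ℓ k a m2 M emb Γ (constBond A₀ Subtype.val + A')).det →
        0 ≤ θ → (∀ x y : ↥(Box d ℓ k M), y.1 ∈ nbrs x.1 → |κ * A' x y| ≤ θ / ((ℓ + 1) ^ k : ℕ)) →
        0 ≤ θ' → (∀ (x z y : ↥(Box d ℓ k M)) (μ : Fin (d + 1)), z.1 = x.1 + e1 μ → y.1 = z.1 + e1 μ →
          |κ * (A' y z - A' z x)| ≤ θ' / (((ℓ + 1) ^ k : ℕ) : ℝ) ^ 2 ∧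
          |κ * (A' x z - A' z y)| ≤ θ' / (((ℓ + 1) ^ k : ℕ) : ℝ) ^ 2) →
        (∀ (x y : ↥(Box d ℓ k M)) (μ : Fin (d + 1)), y.1 = x.1 + e1 μ →
          (x.1 - e1 μ ∉ Box d ℓ k M ∨ y.1 + e1 μ ∉ Box d ℓ k M) → A' x y = 0 ∧ A' y x = 0) →
        0 ≤ τ → (∀ y x, blkWt ((ℓ + 1) ^ k) M (fun i => (ℓ + 1) ^ k * M i) y x ≠ 0 →
          |κ * lsum A' (emb y) (Γ y x)| ≤ τ) →
        ((d : ℝ) + 2) * c * (((d : ℝ) + 1) * ℓ₁ * (θ + θ') + ((d : ℝ) + 1) * ℓ₁ * θ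
          + ((d : ℝ) + 1) * ℓ₁ ^ 2 * θ ^ 2 + B1.aSeq a ((ℓ : ℝ) + 1) k * (ℓ₁ * τ * (2 + ℓ₁ * τ))) ≤ 1 / 2 →
        ∀ (p : ℝ), 1 ≤ p →
        ∀ (N : (↥(Box d ℓ k M) × ι → ℝ) → ℝ), (∀ Φ Ψ, N (Φ + Ψ) ≤ N Φ + N Ψ) →
          (∀ g : ↥(Box d ℓ k M) → Matrix ι ι ℝ, IsGauge g → ∀ Φ, N (blockDiag g *ᵥ Φ) = N Φ) →
          (∀ (μ : Fin (d + 1)) (u : ↥(Box d ℓ k M) × ι → ℝ),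
            N ((derivA d F κ ℓ k M (constBond A₀ Subtype.val + A') μ - derivA0 d F κ ℓ k M A₀ μ) *ᵥ u)
              ≤ ℓ₁ * θ * N u) →
        ∀ (C : ℝ), 0 ≤ C →
          (∀ Φ : ↥(Box d ℓ k M) × ι → ℝ, N ((gk d ℓ k a m2 M ⊗ₖ (1 : Matrix ι ι ℝ)) *ᵥ Φ) ≤ C * lpM p Φ) →
          (∀ (μ : Fin (d + 1)) (Φ : ↥(Box d ℓ k M) × ι → ℝ),
            N ((dk d ℓ k M μ ⊗ₖ (1 : Matrix ι ι ℝ)) *ᵥ ((gk d ℓ k a m2 M ⊗ₖ (1 : Matrix ι ι ℝ)) *ᵥ Φ))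
              ≤ C * lpM p Φ) →
        ∀ f : ↥(Box d ℓ k M) × ι → ℝ,
          N (greenA d F κ ℓ k a m2 M emb Γ (constBond A₀ Subtype.val + A') *ᵥ f) ≤ 2 * C * lpM p f ∧
          (∀ μ : Fin (d + 1),
            N (derivA0 d F κ ℓ k M A₀ μ *ᵥ (greenA d F κ ℓ k a m2 M emb Γ (constBond A₀ Subtype.val + A') *ᵥ f))
              ≤ 2 * C * lpM p f) ∧
          ∀ μ : Fin (d + 1),
            N (derivA d F κ ℓ k M (constBond A₀ Subtype.val + A') μ
                *ᵥ (greenA d F κ ℓ k a m2 M emb Γ (constBond A₀ Subtype.val + A') *ᵥ f))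
              ≤ (1 + ℓ₁ * θ) * (2 * C) * lpM p f := by
  obtain ⟨c, hc, h₁⟩ := const_box_lp F κ d ℓ hℓ amin aplus m2plus ha
  refine ⟨c, hc, ?_⟩
  intro k hk a m2 e1' e2 e3 e4 M hM emb Γ hend A₀ A' θ θ' τ hunit hθ hA' hθ' hder hbd hτ0 hτ hsm p hp N hNadd hNg
    hNconv C hC hN0 hND f
  have hn : 1 ≤ (ℓ + 1) ^ k := Nat.one_le_pow _ _ (Nat.succ_pos ℓ)
  have hL : (1 : ℝ) < (ℓ : ℝ) + 1 := by
    have : (1 : ℝ) ≤ ℓ := by exact_mod_cast hℓ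
    linarith
  have hak : 0 < B1.aSeq a ((ℓ : ℝ) + 1) k := B1.aSeq_pos (lt_of_lt_of_le ha e1') hL hk
  have hε : 0 ≤ ((d : ℝ) + 1) * ℓ₁ * (θ + θ') + ((d : ℝ) + 1) * ℓ₁ * θ + ((d : ℝ) + 1) * ℓ₁ ^ 2 * θ ^ 2
      + B1.aSeq a ((ℓ : ℝ) + 1) k * (ℓ₁ * τ * (2 + ℓ₁ * τ)) := by
    have := hak.le
    positivity
  have hres := greenA_resolvent F κ hℓ hk (lt_of_lt_of_le ha e1') e3 hM hend A₀ hunit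
  have hsm' : ((Fintype.card (Fin (d + 1)) : ℝ) + 1) * c * (((d : ℝ) + 1) * ℓ₁ * (θ + θ')
      + ((d : ℝ) + 1) * ℓ₁ * θ + ((d : ℝ) + 1) * ℓ₁ ^ 2 * θ ^ 2
      + B1.aSeq a ((ℓ : ℝ) + 1) k * (ℓ₁ * τ * (2 + ℓ₁ * τ))) ≤ 1 / 2 := by
    rw [card_dir_add_one]; exact hsm
  -- the source-side (`‖·‖_p`, diagonal) hypotheses of the bootstrap
  obtain ⟨h0, hD⟩ := h₁ k hk a m2 e1' e2 e3 e4 M hM emb Γ hend A₀ p hp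
  have hV := firstOrderSmall_pertV_lp F hℓ₁ hLip κ hℓ hk (lt_of_lt_of_le ha e1') M emb Γ A₀ hθ hA' hθ' hder hbd
    hτ0 hτ hp
  -- the target-side constant-field pair bounds, from the zero-field ones by the gauge step
  have hS : IsUnit (scalarOp (boxWt ((ℓ + 1) ^ k) (fun i => (ℓ + 1) ^ k * M i)) m2
      (B1.aSeq a ((ℓ : ℝ) + 1) k * (((((ℓ + 1) ^ k : ℕ)) : ℝ) ^ (d + 1))⁻¹)
      (blkWt ((ℓ + 1) ^ k) M (fun i => (ℓ + 1) ^ k * M i))).det := by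
    rw [scalarOp_box hn]
    exact boxOpR_det_isUnit hn hak e3 hM
  have hg : IsGauge (fun u : ↥(Box d ℓ k M) => F.U (κ * linGauge A₀ Subtype.val u)) := F.isGauge _
  have hG : greenA0 d F κ ℓ k a m2 M emb Γ A₀
      = blockDiag (fun u : ↥(Box d ℓ k M) => F.U (κ * linGauge A₀ Subtype.val u))
          * (gk d ℓ k a m2 M ⊗ₖ (1 : Matrix ι ι ℝ))
          * (blockDiag fun u : ↥(Box d ℓ k M) => F.U (κ * linGauge A₀ Subtype.val u))ᵀ := by
    dsimp only [greenA0]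
    rw [b4Green_constBond F κ _ m2 _ hend A₀ _ hS, scalarOp_box hn]
  have hDer : ∀ μ, derivA0 d F κ ℓ k M A₀ μ
      = blockDiag (fun u : ↥(Box d ℓ k M) => F.U (κ * linGauge A₀ Subtype.val u))
          * (dk d ℓ k M μ ⊗ₖ (1 : Matrix ι ι ℝ))
          * (blockDiag fun u : ↥(Box d ℓ k M) => F.U (κ * linGauge A₀ Subtype.val u))ᵀ := fun μ => by
    dsimp only [derivA0]
    rw [covDeriv_constBond]
  obtain ⟨c0, cD⟩ := hyps_conj₂ (K := Fin (d + 1)) (D := fun μ => dk d ℓ k M μ ⊗ₖ (1 : Matrix ι ι ℝ))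
    (hNg _ hg) (lpM_gauge_transpose p hg) hg hN0 hND
  have hN0' : ∀ Φ : ↥(Box d ℓ k M) × ι → ℝ, N (greenA0 d F κ ℓ k a m2 M emb Γ A₀ *ᵥ Φ) ≤ C * lpM p Φ :=
    fun Φ => by rw [hG]; exact c0 Φ
  have hND' : ∀ (μ : Fin (d + 1)) (Φ : ↥(Box d ℓ k M) × ι → ℝ),
      N (derivA0 d F κ ℓ k M A₀ μ *ᵥ (greenA0 d F κ ℓ k a m2 M emb Γ A₀ *ᵥ Φ)) ≤ C * lpM p Φ :=
    fun μ Φ => by rw [hG, hDer μ]; exact cD μ Φ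
  -- (2.33): members 1 and 2 (`A₀`-convention)
  have mem1 : ∀ Φ : ↥(Box d ℓ k M) × ι → ℝ,
      N (greenA d F κ ℓ k a m2 M emb Γ (constBond A₀ Subtype.val + A') *ᵥ Φ) ≤ 2 * C * lpM p Φ := fun Φ =>
    transfer (κ := Fin (d + 1)) (lpM_nonneg p) (lpM_add_le hp) hres hc.le hε h0 hD hV hsm' hNadd hC hN0' Φ
  have mem2 : ∀ (μ : Fin (d + 1)) (Φ : ↥(Box d ℓ k M) × ι → ℝ),
      N (derivA0 d F κ ℓ k M A₀ μ *ᵥ (greenA d F κ ℓ k a m2 M emb Γ (constBond A₀ Subtype.val + A') *ᵥ Φ))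
        ≤ 2 * C * lpM p Φ := fun μ Φ =>
    transfer_deriv (κ := Fin (d + 1)) (lpM_nonneg p) (lpM_add_le hp) hres hc.le hε h0 hD hV hsm' hNadd hC
      (hND' μ) Φ
  refine ⟨mem1 f, fun μ => mem2 μ f, fun μ => ?_⟩
  -- member 2, `Ã`-convention: `D_Ã G f = D_{A₀} G f + (D_Ã − D_{A₀}) G f`
  have hsplit : derivA d F κ ℓ k M (constBond A₀ Subtype.val + A') μ
      *ᵥ (greenA d F κ ℓ k a m2 M emb Γ (constBond A₀ Subtype.val + A') *ᵥ f)
      = derivA0 d F κ ℓ k M A₀ μ *ᵥ (greenA d F κ ℓ k a m2 M emb Γ (constBond A₀ Subtype.val + A') *ᵥ f)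
        + (derivA d F κ ℓ k M (constBond A₀ Subtype.val + A') μ - derivA0 d F κ ℓ k M A₀ μ)
          *ᵥ (greenA d F κ ℓ k a m2 M emb Γ (constBond A₀ Subtype.val + A') *ᵥ f) := by
    rw [sub_mulVec]; abel
  have hℓθ : 0 ≤ ℓ₁ * θ := mul_nonneg hℓ₁ hθ
  calc N (derivA d F κ ℓ k M (constBond A₀ Subtype.val + A') μ
        *ᵥ (greenA d F κ ℓ k a m2 M emb Γ (constBond A₀ Subtype.val + A') *ᵥ f))
        = N (derivA0 d F κ ℓ k M A₀ μ *ᵥ (greenA d F κ ℓ k a m2 M emb Γ (constBond A₀ Subtype.val + A') *ᵥ f)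
          + (derivA d F κ ℓ k M (constBond A₀ Subtype.val + A') μ - derivA0 d F κ ℓ k M A₀ μ)
            *ᵥ (greenA d F κ ℓ k a m2 M emb Γ (constBond A₀ Subtype.val + A') *ᵥ f)) := by rw [← hsplit]
    _ ≤ N (derivA0 d F κ ℓ k M A₀ μ *ᵥ (greenA d F κ ℓ k a m2 M emb Γ (constBond A₀ Subtype.val + A') *ᵥ f))
          + N ((derivA d F κ ℓ k M (constBond A₀ Subtype.val + A') μ - derivA0 d F κ ℓ k M A₀ μ)
            *ᵥ (greenA d F κ ℓ k a m2 M emb Γ (constBond A₀ Subtype.val + A') *ᵥ f)) := hNadd _ _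
    _ ≤ 2 * C * lpM p f
          + ℓ₁ * θ * N (greenA d F κ ℓ k a m2 M emb Γ (constBond A₀ Subtype.val + A') *ᵥ f) :=
        add_le_add (mem2 μ f) (hNconv μ _)
    _ ≤ 2 * C * lpM p f + ℓ₁ * θ * (2 * C * lpM p f) :=
        add_le_add le_rfl (mul_le_mul_of_nonneg_left (mem1 f) hℓθ)
    _ = (1 + ℓ₁ * θ) * (2 * C) * lpM p f := by ring

/-- **(2.17) OFF THE DIAGONAL, `L^p → L^q`, MEMBERS `G`, `D^η_μG` (BOTH CONVENTIONS), FOR `G_k(□,Ã)` ON A BOX —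
REDUCED TO THE ZERO-FIELD PAIR BOUND**: for all real `p, q ≥ 1` and `C ≥ 0`, IF `‖(G_k(□)⊗1)Φ‖_q ≤ C‖Φ‖_p` and
`‖(D^η_μ⊗1)(G_k(□)⊗1)Φ‖_q ≤ C‖Φ‖_p`, THEN (under the hypotheses of `B4Lemma22LpStair.lemma22_17_lp_box`)
`‖Gf‖_q ≤ 2C‖f‖_p`, `‖D^η_{A₀,μ}Gf‖_q ≤ 2C‖f‖_p`, `‖D^η_{Ã,μ}Gf‖_q ≤ (1+ℓθ)2C‖f‖_p` («(2.17) ‖G_k(□,Ã)f‖_q,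
‖D^η_{Ã,μ}G_k(□,Ã)f‖_q, ‖G_k(□,Ã)D^{η*}_{Ã,μ}f‖_q ≤ c₂‖f‖_p»).  `N = ‖·‖_q` in `lemma22_17_transfer_box`: Minkowski,
gauge invariance `B4Lemma22LpStair.lpM_gauge`, conversion `B4Lemma22LpStair.covDeriv_sub_lpM_le`.
[cite: Balaban1983RegularityDecay, Lemma 2.2 (2.17) p. 578; proof p. 581 (2.31)–(2.33)] -/
theorem lemma22_17_pq_box (F : OrthFlow ι) {ℓ₁ : ℝ} (hℓ₁ : 0 ≤ ℓ₁)
    (hLip : ∀ t (v : ι → ℝ), ((F.U t - 1) *ᵥ v) ⬝ᵥ ((F.U t - 1) *ᵥ v) ≤ (ℓ₁ * t) ^ 2 * (v ⬝ᵥ v))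
    (κ : ℝ) (d ℓ : ℕ) (hℓ : 1 ≤ ℓ) (amin aplus m2plus : ℝ) (ha : 0 < amin) :
    ∃ c : ℝ, 0 < c ∧ ∀ (k : ℕ), 1 ≤ k → ∀ (a m2 : ℝ), amin ≤ a → a ≤ aplus → 0 ≤ m2 → m2 ≤ m2plus →
      ∀ (M : Fin (d + 1) → ℕ), (∀ i, 1 ≤ M i) →
      ∀ (emb : ↥(boxDom M) → ↥(Box d ℓ k M)) (Γ : ↥(boxDom M) → ↥(Box d ℓ k M) → List ↥(Box d ℓ k M)),
        (∀ y x, blkWt ((ℓ + 1) ^ k) M (fun i => (ℓ + 1) ^ k * M i) y x ≠ 0 → pathEnd (emb y) (Γ y x) = x) →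
      ∀ (A₀ : Fin (d + 1) → ℝ) (A' : ↥(Box d ℓ k M) → ↥(Box d ℓ k M) → ℝ) (θ θ' τ : ℝ),
        IsUnit (opA d F κ ℓ k a m2 M emb Γ (constBond A₀ Subtype.val + A')).det →
        0 ≤ θ → (∀ x y : ↥(Box d ℓ k M), y.1 ∈ nbrs x.1 → |κ * A' x y| ≤ θ / ((ℓ + 1) ^ k : ℕ)) →
        0 ≤ θ' → (∀ (x z y : ↥(Box d ℓ k M)) (μ : Fin (d + 1)), z.1 = x.1 + e1 μ → y.1 = z.1 + e1 μ →
          |κ * (A' y z - A' z x)| ≤ θ' / (((ℓ + 1) ^ k : ℕ) : ℝ) ^ 2 ∧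
          |κ * (A' x z - A' z y)| ≤ θ' / (((ℓ + 1) ^ k : ℕ) : ℝ) ^ 2) →
        (∀ (x y : ↥(Box d ℓ k M)) (μ : Fin (d + 1)), y.1 = x.1 + e1 μ →
          (x.1 - e1 μ ∉ Box d ℓ k M ∨ y.1 + e1 μ ∉ Box d ℓ k M) → A' x y = 0 ∧ A' y x = 0) →
        0 ≤ τ → (∀ y x, blkWt ((ℓ + 1) ^ k) M (fun i => (ℓ + 1) ^ k * M i) y x ≠ 0 →
          |κ * lsum A' (emb y) (Γ y x)| ≤ τ) →
        ((d : ℝ) + 2) * c * (((d : ℝ) + 1) * ℓ₁ * (θ + θ') + ((d : ℝ) + 1) * ℓ₁ * θ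
          + ((d : ℝ) + 1) * ℓ₁ ^ 2 * θ ^ 2 + B1.aSeq a ((ℓ : ℝ) + 1) k * (ℓ₁ * τ * (2 + ℓ₁ * τ))) ≤ 1 / 2 →
        ∀ (p q : ℝ), 1 ≤ p → 1 ≤ q → ∀ (C : ℝ), 0 ≤ C →
          (∀ Φ : ↥(Box d ℓ k M) × ι → ℝ, lpM q ((gk d ℓ k a m2 M ⊗ₖ (1 : Matrix ι ι ℝ)) *ᵥ Φ) ≤ C * lpM p Φ) →
          (∀ (μ : Fin (d + 1)) (Φ : ↥(Box d ℓ k M) × ι → ℝ),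
            lpM q ((dk d ℓ k M μ ⊗ₖ (1 : Matrix ι ι ℝ)) *ᵥ ((gk d ℓ k a m2 M ⊗ₖ (1 : Matrix ι ι ℝ)) *ᵥ Φ))
              ≤ C * lpM p Φ) →
        ∀ f : ↥(Box d ℓ k M) × ι → ℝ,
          lpM q (greenA d F κ ℓ k a m2 M emb Γ (constBond A₀ Subtype.val + A') *ᵥ f) ≤ 2 * C * lpM p f ∧
          (∀ μ : Fin (d + 1),
            lpM q (derivA0 d F κ ℓ k M A₀ μ
                *ᵥ (greenA d F κ ℓ k a m2 M emb Γ (constBond A₀ Subtype.val + A') *ᵥ f)) ≤ 2 * C * lpM p f) ∧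
          ∀ μ : Fin (d + 1),
            lpM q (derivA d F κ ℓ k M (constBond A₀ Subtype.val + A') μ
                *ᵥ (greenA d F κ ℓ k a m2 M emb Γ (constBond A₀ Subtype.val + A') *ᵥ f))
              ≤ (1 + ℓ₁ * θ) * (2 * C) * lpM p f := by
  obtain ⟨c, hc, h⟩ := lemma22_17_transfer_box F hℓ₁ hLip κ d ℓ hℓ amin aplus m2plus ha
  refine ⟨c, hc, ?_⟩
  intro k hk a m2 e1' e2 e3 e4 M hM emb Γ hend A₀ A' θ θ' τ hunit hθ hA' hθ' hder hbd hτ0 hτ hsm p q hp hq C hC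
    hN0 hND f
  have hn : 1 ≤ (ℓ + 1) ^ k := Nat.one_le_pow _ _ (Nat.succ_pos ℓ)
  exact h k hk a m2 e1' e2 e3 e4 M hM emb Γ hend A₀ A' θ θ' τ hunit hθ hA' hθ' hder hbd hτ0 hτ hsm p hp (lpM q)
    (lpM_add_le hq) (fun g hg Φ => lpM_gauge q hg Φ)
    (fun μ u => covDeriv_sub_lpM_le F hℓ₁ hLip κ hn (constBond A₀ Subtype.val) hθ
      (fun x y hy => hA' x y (hy ▸ add_e1_mem_nbrs x.1 μ)) hq u) C hC hN0 hND f

/-- **(2.17) OFF THE DIAGONAL, `L^p → L^∞`, MEMBERS `G`, `D^η_μG` (BOTH CONVENTIONS), FOR `G_k(□,Ã)` ON A BOX —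
REDUCED TO THE ZERO-FIELD PAIR BOUND**: for every real `p ≥ 1` and `C ≥ 0`, IF `‖(G_k(□)⊗1)Φ‖_∞ ≤ C‖Φ‖_p` and
`‖(D^η_μ⊗1)(G_k(□)⊗1)Φ‖_∞ ≤ C‖Φ‖_p`, THEN `‖Gf‖_∞ ≤ 2C‖f‖_p`, `‖D^η_{A₀,μ}Gf‖_∞ ≤ 2C‖f‖_p`,
`‖D^η_{Ã,μ}Gf‖_∞ ≤ (1+ℓθ)2C‖f‖_p`.  `N = ‖·‖_∞` in `lemma22_17_transfer_box`: `supN_add_le`,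
`B4Lemma22ReduceZero.supN_gauge`, `B4Lemma22ReduceDeriv.covDeriv_sub_supN_le`.
[cite: Balaban1983RegularityDecay, Lemma 2.2 (2.17) p. 578; proof p. 581 (2.31)–(2.33)] -/
theorem lemma22_17_psup_box (F : OrthFlow ι) {ℓ₁ : ℝ} (hℓ₁ : 0 ≤ ℓ₁)
    (hLip : ∀ t (v : ι → ℝ), ((F.U t - 1) *ᵥ v) ⬝ᵥ ((F.U t - 1) *ᵥ v) ≤ (ℓ₁ * t) ^ 2 * (v ⬝ᵥ v))
    (κ : ℝ) (d ℓ : ℕ) (hℓ : 1 ≤ ℓ) (amin aplus m2plus : ℝ) (ha : 0 < amin) :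
    ∃ c : ℝ, 0 < c ∧ ∀ (k : ℕ), 1 ≤ k → ∀ (a m2 : ℝ), amin ≤ a → a ≤ aplus → 0 ≤ m2 → m2 ≤ m2plus →
      ∀ (M : Fin (d + 1) → ℕ), (∀ i, 1 ≤ M i) →
      ∀ (emb : ↥(boxDom M) → ↥(Box d ℓ k M)) (Γ : ↥(boxDom M) → ↥(Box d ℓ k M) → List ↥(Box d ℓ k M)),
        (∀ y x, blkWt ((ℓ + 1) ^ k) M (fun i => (ℓ + 1) ^ k * M i) y x ≠ 0 → pathEnd (emb y) (Γ y x) = x) →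
      ∀ (A₀ : Fin (d + 1) → ℝ) (A' : ↥(Box d ℓ k M) → ↥(Box d ℓ k M) → ℝ) (θ θ' τ : ℝ),
        IsUnit (opA d F κ ℓ k a m2 M emb Γ (constBond A₀ Subtype.val + A')).det →
        0 ≤ θ → (∀ x y : ↥(Box d ℓ k M), y.1 ∈ nbrs x.1 → |κ * A' x y| ≤ θ / ((ℓ + 1) ^ k : ℕ)) →
        0 ≤ θ' → (∀ (x z y : ↥(Box d ℓ k M)) (μ : Fin (d + 1)), z.1 = x.1 + e1 μ → y.1 = z.1 + e1 μ →
          |κ * (A' y z - A' z x)| ≤ θ' / (((ℓ + 1) ^ k : ℕ) : ℝ) ^ 2 ∧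
          |κ * (A' x z - A' z y)| ≤ θ' / (((ℓ + 1) ^ k : ℕ) : ℝ) ^ 2) →
        (∀ (x y : ↥(Box d ℓ k M)) (μ : Fin (d + 1)), y.1 = x.1 + e1 μ →
          (x.1 - e1 μ ∉ Box d ℓ k M ∨ y.1 + e1 μ ∉ Box d ℓ k M) → A' x y = 0 ∧ A' y x = 0) →
        0 ≤ τ → (∀ y x, blkWt ((ℓ + 1) ^ k) M (fun i => (ℓ + 1) ^ k * M i) y x ≠ 0 →
          |κ * lsum A' (emb y) (Γ y x)| ≤ τ) →
        ((d : ℝ) + 2) * c * (((d : ℝ) + 1) * ℓ₁ * (θ + θ') + ((d : ℝ) + 1) * ℓ₁ * θ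
          + ((d : ℝ) + 1) * ℓ₁ ^ 2 * θ ^ 2 + B1.aSeq a ((ℓ : ℝ) + 1) k * (ℓ₁ * τ * (2 + ℓ₁ * τ))) ≤ 1 / 2 →
        ∀ (p : ℝ), 1 ≤ p → ∀ (C : ℝ), 0 ≤ C →
          (∀ Φ : ↥(Box d ℓ k M) × ι → ℝ, supN ((gk d ℓ k a m2 M ⊗ₖ (1 : Matrix ι ι ℝ)) *ᵥ Φ) ≤ C * lpM p Φ) →
          (∀ (μ : Fin (d + 1)) (Φ : ↥(Box d ℓ k M) × ι → ℝ),
            supN ((dk d ℓ k M μ ⊗ₖ (1 : Matrix ι ι ℝ)) *ᵥ ((gk d ℓ k a m2 M ⊗ₖ (1 : Matrix ι ι ℝ)) *ᵥ Φ))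
              ≤ C * lpM p Φ) →
        ∀ f : ↥(Box d ℓ k M) × ι → ℝ,
          supN (greenA d F κ ℓ k a m2 M emb Γ (constBond A₀ Subtype.val + A') *ᵥ f) ≤ 2 * C * lpM p f ∧
          (∀ μ : Fin (d + 1),
            supN (derivA0 d F κ ℓ k M A₀ μ
                *ᵥ (greenA d F κ ℓ k a m2 M emb Γ (constBond A₀ Subtype.val + A') *ᵥ f)) ≤ 2 * C * lpM p f) ∧
          ∀ μ : Fin (d + 1),
            supN (derivA d F κ ℓ k M (constBond A₀ Subtype.val + A') μ
                *ᵥ (greenA d F κ ℓ k a m2 M emb Γ (constBond A₀ Subtype.val + A') *ᵥ f))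
              ≤ (1 + ℓ₁ * θ) * (2 * C) * lpM p f := by
  obtain ⟨c, hc, h⟩ := lemma22_17_transfer_box F hℓ₁ hLip κ d ℓ hℓ amin aplus m2plus ha
  refine ⟨c, hc, ?_⟩
  intro k hk a m2 e1' e2 e3 e4 M hM emb Γ hend A₀ A' θ θ' τ hunit hθ hA' hθ' hder hbd hτ0 hτ hsm p hp C hC hN0 hND f
  have hn : 1 ≤ (ℓ + 1) ^ k := Nat.one_le_pow _ _ (Nat.succ_pos ℓ)
  exact h k hk a m2 e1' e2 e3 e4 M hM emb Γ hend A₀ A' θ θ' τ hunit hθ hA' hθ' hder hbd hτ0 hτ hsm p hp supN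
    supN_add_le (fun g hg Φ => supN_gauge hg Φ)
    (fun μ u => covDeriv_sub_supN_le F hℓ₁ hLip κ hn (constBond A₀ Subtype.val) hθ
      (fun x y hy => hA' x y (hy ▸ add_e1_mem_nbrs x.1 μ)) u) C hC hN0 hND f

end Transfer

/-! ## §4 THE THIRD MEMBER `G D^{η*}_μ` AT THE PAIR `(p,q)` FROM THE ZERO-FIELD BOUND AT THE DUAL PAIR `(q',p')` -/

section Dual

variable {d : ℕ}

/-- **(2.17) OFF THE DIAGONAL, THIRD MEMBER `G_k(□,Ã)D^{η*}_μ` (BOTH CONVENTIONS), `L^p → L^q` WITH `1 < p, q < ∞`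
— REDUCED TO THE ZERO-FIELD BOUND AT THE DUAL PAIR**: for Hölder conjugates `p' , q'` and `C ≥ 0`, IF
`‖(G_k(□)⊗1)Φ‖_{p'} ≤ C‖Φ‖_{q'}` and `‖(D^η_μ⊗1)(G_k(□)⊗1)Φ‖_{p'} ≤ C‖Φ‖_{q'}`, THEN (under the hypotheses of
`B4Lemma22LpStair.lemma22_17_lp_box`) `‖G(D^η_{A₀,μ})ᵀf‖_q ≤ 2C‖f‖_p` and `‖G(D^η_{Ã,μ})ᵀf‖_q ≤ (1+ℓθ)2C‖f‖_p`
(`(D^η_μ)ᵀ = D^{η*}_μ`; `G(D_μ)ᵀ = (D_μG)ᵀ` by `Gᵀ = G`, `B4Lemma22DualL1.b4Green_transpose`; member 2 at `(q',p')`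
by `lemma22_17_pq_box`, then `lpM_transpose_le_pq`) — «Again by the duality argument».
[cite: Balaban1983RegularityDecay, Lemma 2.2 (2.17) p. 578; p. 581; p. 583] -/
theorem lemma22_17_pq_box_dual (F : OrthFlow ι) {ℓ₁ : ℝ} (hℓ₁ : 0 ≤ ℓ₁)
    (hLip : ∀ t (v : ι → ℝ), ((F.U t - 1) *ᵥ v) ⬝ᵥ ((F.U t - 1) *ᵥ v) ≤ (ℓ₁ * t) ^ 2 * (v ⬝ᵥ v))
    (κ : ℝ) (d ℓ : ℕ) (hℓ : 1 ≤ ℓ) (amin aplus m2plus : ℝ) (ha : 0 < amin) :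
    ∃ c : ℝ, 0 < c ∧ ∀ (k : ℕ), 1 ≤ k → ∀ (a m2 : ℝ), amin ≤ a → a ≤ aplus → 0 ≤ m2 → m2 ≤ m2plus →
      ∀ (M : Fin (d + 1) → ℕ), (∀ i, 1 ≤ M i) →
      ∀ (emb : ↥(boxDom M) → ↥(Box d ℓ k M)) (Γ : ↥(boxDom M) → ↥(Box d ℓ k M) → List ↥(Box d ℓ k M)),
        (∀ y x, blkWt ((ℓ + 1) ^ k) M (fun i => (ℓ + 1) ^ k * M i) y x ≠ 0 → pathEnd (emb y) (Γ y x) = x) →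
      ∀ (A₀ : Fin (d + 1) → ℝ) (A' : ↥(Box d ℓ k M) → ↥(Box d ℓ k M) → ℝ) (θ θ' τ : ℝ),
        IsUnit (opA d F κ ℓ k a m2 M emb Γ (constBond A₀ Subtype.val + A')).det →
        0 ≤ θ → (∀ x y : ↥(Box d ℓ k M), y.1 ∈ nbrs x.1 → |κ * A' x y| ≤ θ / ((ℓ + 1) ^ k : ℕ)) →
        0 ≤ θ' → (∀ (x z y : ↥(Box d ℓ k M)) (μ : Fin (d + 1)), z.1 = x.1 + e1 μ → y.1 = z.1 + e1 μ →
          |κ * (A' y z - A' z x)| ≤ θ' / (((ℓ + 1) ^ k : ℕ) : ℝ) ^ 2 ∧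
          |κ * (A' x z - A' z y)| ≤ θ' / (((ℓ + 1) ^ k : ℕ) : ℝ) ^ 2) →
        (∀ (x y : ↥(Box d ℓ k M)) (μ : Fin (d + 1)), y.1 = x.1 + e1 μ →
          (x.1 - e1 μ ∉ Box d ℓ k M ∨ y.1 + e1 μ ∉ Box d ℓ k M) → A' x y = 0 ∧ A' y x = 0) →
        0 ≤ τ → (∀ y x, blkWt ((ℓ + 1) ^ k) M (fun i => (ℓ + 1) ^ k * M i) y x ≠ 0 →
          |κ * lsum A' (emb y) (Γ y x)| ≤ τ) →
        ((d : ℝ) + 2) * c * (((d : ℝ) + 1) * ℓ₁ * (θ + θ') + ((d : ℝ) + 1) * ℓ₁ * θ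
          + ((d : ℝ) + 1) * ℓ₁ ^ 2 * θ ^ 2 + B1.aSeq a ((ℓ : ℝ) + 1) k * (ℓ₁ * τ * (2 + ℓ₁ * τ))) ≤ 1 / 2 →
        ∀ (p p' q q' : ℝ), p.HolderConjugate p' → q.HolderConjugate q' → ∀ (C : ℝ), 0 ≤ C →
          (∀ Φ : ↥(Box d ℓ k M) × ι → ℝ,
            lpM p' ((gk d ℓ k a m2 M ⊗ₖ (1 : Matrix ι ι ℝ)) *ᵥ Φ) ≤ C * lpM q' Φ) →
          (∀ (μ : Fin (d + 1)) (Φ : ↥(Box d ℓ k M) × ι → ℝ),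
            lpM p' ((dk d ℓ k M μ ⊗ₖ (1 : Matrix ι ι ℝ)) *ᵥ ((gk d ℓ k a m2 M ⊗ₖ (1 : Matrix ι ι ℝ)) *ᵥ Φ))
              ≤ C * lpM q' Φ) →
        ∀ f : ↥(Box d ℓ k M) × ι → ℝ,
          (∀ μ : Fin (d + 1),
            lpM q ((greenA d F κ ℓ k a m2 M emb Γ (constBond A₀ Subtype.val + A')
                * (derivA0 d F κ ℓ k M A₀ μ)ᵀ) *ᵥ f) ≤ 2 * C * lpM p f) ∧
          ∀ μ : Fin (d + 1),
            lpM q ((greenA d F κ ℓ k a m2 M emb Γ (constBond A₀ Subtype.val + A')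
                * (derivA d F κ ℓ k M (constBond A₀ Subtype.val + A') μ)ᵀ) *ᵥ f)
              ≤ (1 + ℓ₁ * θ) * (2 * C) * lpM p f := by
  obtain ⟨c, hc, h⟩ := lemma22_17_pq_box F hℓ₁ hLip κ d ℓ hℓ amin aplus m2plus ha
  refine ⟨c, hc, ?_⟩
  intro k hk a m2 e1' e2 e3 e4 M hM emb Γ hend A₀ A' θ θ' τ hunit hθ hA' hθ' hder hbd hτ0 hτ hsm p p' q q' hpc hqc
    C hC hN0 hND f
  have key := h k hk a m2 e1' e2 e3 e4 M hM emb Γ hend A₀ A' θ θ' τ hunit hθ hA' hθ' hder hbd hτ0 hτ hsm q' p'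
    hqc.symm.lt.le hpc.symm.lt.le C hC hN0 hND
  have hGt : (greenA d F κ ℓ k a m2 M emb Γ (constBond A₀ Subtype.val + A'))ᵀ
      = greenA d F κ ℓ k a m2 M emb Γ (constBond A₀ Subtype.val + A') := b4Green_transpose F κ _ _ _ _ _ _ _
  have hC2 : 0 ≤ 2 * C := by positivity
  have hC3 : 0 ≤ (1 + ℓ₁ * θ) * (2 * C) := by
    have := mul_nonneg hℓ₁ hθ
    positivity
  refine ⟨fun μ => ?_, fun μ => ?_⟩
  · have hT : greenA d F κ ℓ k a m2 M emb Γ (constBond A₀ Subtype.val + A') * (derivA0 d F κ ℓ k M A₀ μ)ᵀ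
        = (derivA0 d F κ ℓ k M A₀ μ * greenA d F κ ℓ k a m2 M emb Γ (constBond A₀ Subtype.val + A'))ᵀ := by
      rw [Matrix.transpose_mul, hGt]
    rw [hT]
    refine lpM_transpose_le_pq hpc hqc hC2 (fun Φ => ?_) f
    rw [← Matrix.mulVec_mulVec]
    exact (key Φ).2.1 μ
  · have hT : greenA d F κ ℓ k a m2 M emb Γ (constBond A₀ Subtype.val + A')
        * (derivA d F κ ℓ k M (constBond A₀ Subtype.val + A') μ)ᵀ
        = (derivA d F κ ℓ k M (constBond A₀ Subtype.val + A') μ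
            * greenA d F κ ℓ k a m2 M emb Γ (constBond A₀ Subtype.val + A'))ᵀ := by
      rw [Matrix.transpose_mul, hGt]
    rw [hT]
    refine lpM_transpose_le_pq hpc hqc hC3 (fun Φ => ?_) f
    rw [← Matrix.mulVec_mulVec]
    exact (key Φ).2.2 μ

/-- **THIRD MEMBER, `L¹ → L^q` (`1 < q < ∞`) — REDUCED TO THE ZERO-FIELD BOUND `L^{q'} → L^∞`**: IF
`‖(G_k(□)⊗1)Φ‖_∞ ≤ C‖Φ‖_{q'}` and `‖(D^η_μ⊗1)(G_k(□)⊗1)Φ‖_∞ ≤ C‖Φ‖_{q'}`, THEN `‖G(D^η_{A₀,μ})ᵀf‖_q ≤ 2C‖f‖₁` and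
`‖G(D^η_{Ã,μ})ᵀf‖_q ≤ (1+ℓθ)2C‖f‖₁` (member 2 at `(q',∞)` by `lemma22_17_psup_box`, then `lpM_transpose_le_of_sup` —
«using the fact that the space L^∞(□) is adjoint to L¹(□)»).
[cite: Balaban1983RegularityDecay, Lemma 2.2 (2.17) p. 578; p. 581; p. 583] -/
theorem lemma22_17_pq_box_dual_one (F : OrthFlow ι) {ℓ₁ : ℝ} (hℓ₁ : 0 ≤ ℓ₁)
    (hLip : ∀ t (v : ι → ℝ), ((F.U t - 1) *ᵥ v) ⬝ᵥ ((F.U t - 1) *ᵥ v) ≤ (ℓ₁ * t) ^ 2 * (v ⬝ᵥ v))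
    (κ : ℝ) (d ℓ : ℕ) (hℓ : 1 ≤ ℓ) (amin aplus m2plus : ℝ) (ha : 0 < amin) :
    ∃ c : ℝ, 0 < c ∧ ∀ (k : ℕ), 1 ≤ k → ∀ (a m2 : ℝ), amin ≤ a → a ≤ aplus → 0 ≤ m2 → m2 ≤ m2plus →
      ∀ (M : Fin (d + 1) → ℕ), (∀ i, 1 ≤ M i) →
      ∀ (emb : ↥(boxDom M) → ↥(Box d ℓ k M)) (Γ : ↥(boxDom M) → ↥(Box d ℓ k M) → List ↥(Box d ℓ k M)),
        (∀ y x, blkWt ((ℓ + 1) ^ k) M (fun i => (ℓ + 1) ^ k * M i) y x ≠ 0 → pathEnd (emb y) (Γ y x) = x) →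
      ∀ (A₀ : Fin (d + 1) → ℝ) (A' : ↥(Box d ℓ k M) → ↥(Box d ℓ k M) → ℝ) (θ θ' τ : ℝ),
        IsUnit (opA d F κ ℓ k a m2 M emb Γ (constBond A₀ Subtype.val + A')).det →
        0 ≤ θ → (∀ x y : ↥(Box d ℓ k M), y.1 ∈ nbrs x.1 → |κ * A' x y| ≤ θ / ((ℓ + 1) ^ k : ℕ)) →
        0 ≤ θ' → (∀ (x z y : ↥(Box d ℓ k M)) (μ : Fin (d + 1)), z.1 = x.1 + e1 μ → y.1 = z.1 + e1 μ →
          |κ * (A' y z - A' z x)| ≤ θ' / (((ℓ + 1) ^ k : ℕ) : ℝ) ^ 2 ∧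
          |κ * (A' x z - A' z y)| ≤ θ' / (((ℓ + 1) ^ k : ℕ) : ℝ) ^ 2) →
        (∀ (x y : ↥(Box d ℓ k M)) (μ : Fin (d + 1)), y.1 = x.1 + e1 μ →
          (x.1 - e1 μ ∉ Box d ℓ k M ∨ y.1 + e1 μ ∉ Box d ℓ k M) → A' x y = 0 ∧ A' y x = 0) →
        0 ≤ τ → (∀ y x, blkWt ((ℓ + 1) ^ k) M (fun i => (ℓ + 1) ^ k * M i) y x ≠ 0 →
          |κ * lsum A' (emb y) (Γ y x)| ≤ τ) →
        ((d : ℝ) + 2) * c * (((d : ℝ) + 1) * ℓ₁ * (θ + θ') + ((d : ℝ) + 1) * ℓ₁ * θ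
          + ((d : ℝ) + 1) * ℓ₁ ^ 2 * θ ^ 2 + B1.aSeq a ((ℓ : ℝ) + 1) k * (ℓ₁ * τ * (2 + ℓ₁ * τ))) ≤ 1 / 2 →
        ∀ (q q' : ℝ), q.HolderConjugate q' → ∀ (C : ℝ), 0 ≤ C →
          (∀ Φ : ↥(Box d ℓ k M) × ι → ℝ,
            supN ((gk d ℓ k a m2 M ⊗ₖ (1 : Matrix ι ι ℝ)) *ᵥ Φ) ≤ C * lpM q' Φ) →
          (∀ (μ : Fin (d + 1)) (Φ : ↥(Box d ℓ k M) × ι → ℝ),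
            supN ((dk d ℓ k M μ ⊗ₖ (1 : Matrix ι ι ℝ)) *ᵥ ((gk d ℓ k a m2 M ⊗ₖ (1 : Matrix ι ι ℝ)) *ᵥ Φ))
              ≤ C * lpM q' Φ) →
        ∀ f : ↥(Box d ℓ k M) × ι → ℝ,
          (∀ μ : Fin (d + 1),
            lpM q ((greenA d F κ ℓ k a m2 M emb Γ (constBond A₀ Subtype.val + A')
                * (derivA0 d F κ ℓ k M A₀ μ)ᵀ) *ᵥ f) ≤ 2 * C * l1N f) ∧
          ∀ μ : Fin (d + 1),
            lpM q ((greenA d F κ ℓ k a m2 M emb Γ (constBond A₀ Subtype.val + A')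
                * (derivA d F κ ℓ k M (constBond A₀ Subtype.val + A') μ)ᵀ) *ᵥ f)
              ≤ (1 + ℓ₁ * θ) * (2 * C) * l1N f := by
  obtain ⟨c, hc, h⟩ := lemma22_17_psup_box F hℓ₁ hLip κ d ℓ hℓ amin aplus m2plus ha
  refine ⟨c, hc, ?_⟩
  intro k hk a m2 e1' e2 e3 e4 M hM emb Γ hend A₀ A' θ θ' τ hunit hθ hA' hθ' hder hbd hτ0 hτ hsm q q' hqc C hC
    hN0 hND f
  have key := h k hk a m2 e1' e2 e3 e4 M hM emb Γ hend A₀ A' θ θ' τ hunit hθ hA' hθ' hder hbd hτ0 hτ hsm q'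
    hqc.symm.lt.le C hC hN0 hND
  have hGt : (greenA d F κ ℓ k a m2 M emb Γ (constBond A₀ Subtype.val + A'))ᵀ
      = greenA d F κ ℓ k a m2 M emb Γ (constBond A₀ Subtype.val + A') := b4Green_transpose F κ _ _ _ _ _ _ _
  have hC2 : 0 ≤ 2 * C := by positivity
  have hC3 : 0 ≤ (1 + ℓ₁ * θ) * (2 * C) := by
    have := mul_nonneg hℓ₁ hθ
    positivity
  refine ⟨fun μ => ?_, fun μ => ?_⟩
  · have hT : greenA d F κ ℓ k a m2 M emb Γ (constBond A₀ Subtype.val + A') * (derivA0 d F κ ℓ k M A₀ μ)ᵀ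
        = (derivA0 d F κ ℓ k M A₀ μ * greenA d F κ ℓ k a m2 M emb Γ (constBond A₀ Subtype.val + A'))ᵀ := by
      rw [Matrix.transpose_mul, hGt]
    rw [hT]
    refine lpM_transpose_le_of_sup hqc hC2 (fun Φ => ?_) f
    rw [← Matrix.mulVec_mulVec]
    exact (key Φ).2.1 μ
  · have hT : greenA d F κ ℓ k a m2 M emb Γ (constBond A₀ Subtype.val + A')
        * (derivA d F κ ℓ k M (constBond A₀ Subtype.val + A') μ)ᵀ
        = (derivA d F κ ℓ k M (constBond A₀ Subtype.val + A') μ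
            * greenA d F κ ℓ k a m2 M emb Γ (constBond A₀ Subtype.val + A'))ᵀ := by
      rw [Matrix.transpose_mul, hGt]
    rw [hT]
    refine lpM_transpose_le_of_sup hqc hC3 (fun Φ => ?_) f
    rw [← Matrix.mulVec_mulVec]
    exact (key Φ).2.2 μ

/-- **THIRD MEMBER, `L^p → L^∞` (`1 < p < ∞`) — REDUCED TO THE ZERO-FIELD BOUND `L¹ → L^{p'}`**: IF
`‖(G_k(□)⊗1)Φ‖_{p'} ≤ C‖Φ‖₁` and `‖(D^η_μ⊗1)(G_k(□)⊗1)Φ‖_{p'} ≤ C‖Φ‖₁`, THEN `‖G(D^η_{A₀,μ})ᵀf‖_∞ ≤ 2C‖f‖_p` and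
`‖G(D^η_{Ã,μ})ᵀf‖_∞ ≤ (1+ℓθ)2C‖f‖_p` (member 2 at `(1,p')` by `lemma22_17_pq_box`, then `supN_transpose_le_of_lp`)
— «bounded operators from L¹(□) to L^{p'₁}(□), p'₁^{−1} + p₁^{−1} = 1».
[cite: Balaban1983RegularityDecay, Lemma 2.2 (2.17) p. 578; p. 581; p. 583] -/
theorem lemma22_17_pq_box_dual_sup (F : OrthFlow ι) {ℓ₁ : ℝ} (hℓ₁ : 0 ≤ ℓ₁)
    (hLip : ∀ t (v : ι → ℝ), ((F.U t - 1) *ᵥ v) ⬝ᵥ ((F.U t - 1) *ᵥ v) ≤ (ℓ₁ * t) ^ 2 * (v ⬝ᵥ v))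
    (κ : ℝ) (d ℓ : ℕ) (hℓ : 1 ≤ ℓ) (amin aplus m2plus : ℝ) (ha : 0 < amin) :
    ∃ c : ℝ, 0 < c ∧ ∀ (k : ℕ), 1 ≤ k → ∀ (a m2 : ℝ), amin ≤ a → a ≤ aplus → 0 ≤ m2 → m2 ≤ m2plus →
      ∀ (M : Fin (d + 1) → ℕ), (∀ i, 1 ≤ M i) →
      ∀ (emb : ↥(boxDom M) → ↥(Box d ℓ k M)) (Γ : ↥(boxDom M) → ↥(Box d ℓ k M) → List ↥(Box d ℓ k M)),
        (∀ y x, blkWt ((ℓ + 1) ^ k) M (fun i => (ℓ + 1) ^ k * M i) y x ≠ 0 → pathEnd (emb y) (Γ y x) = x) →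
      ∀ (A₀ : Fin (d + 1) → ℝ) (A' : ↥(Box d ℓ k M) → ↥(Box d ℓ k M) → ℝ) (θ θ' τ : ℝ),
        IsUnit (opA d F κ ℓ k a m2 M emb Γ (constBond A₀ Subtype.val + A')).det →
        0 ≤ θ → (∀ x y : ↥(Box d ℓ k M), y.1 ∈ nbrs x.1 → |κ * A' x y| ≤ θ / ((ℓ + 1) ^ k : ℕ)) →
        0 ≤ θ' → (∀ (x z y : ↥(Box d ℓ k M)) (μ : Fin (d + 1)), z.1 = x.1 + e1 μ → y.1 = z.1 + e1 μ →
          |κ * (A' y z - A' z x)| ≤ θ' / (((ℓ + 1) ^ k : ℕ) : ℝ) ^ 2 ∧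
          |κ * (A' x z - A' z y)| ≤ θ' / (((ℓ + 1) ^ k : ℕ) : ℝ) ^ 2) →
        (∀ (x y : ↥(Box d ℓ k M)) (μ : Fin (d + 1)), y.1 = x.1 + e1 μ →
          (x.1 - e1 μ ∉ Box d ℓ k M ∨ y.1 + e1 μ ∉ Box d ℓ k M) → A' x y = 0 ∧ A' y x = 0) →
        0 ≤ τ → (∀ y x, blkWt ((ℓ + 1) ^ k) M (fun i => (ℓ + 1) ^ k * M i) y x ≠ 0 →
          |κ * lsum A' (emb y) (Γ y x)| ≤ τ) →
        ((d : ℝ) + 2) * c * (((d : ℝ) + 1) * ℓ₁ * (θ + θ') + ((d : ℝ) + 1) * ℓ₁ * θ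
          + ((d : ℝ) + 1) * ℓ₁ ^ 2 * θ ^ 2 + B1.aSeq a ((ℓ : ℝ) + 1) k * (ℓ₁ * τ * (2 + ℓ₁ * τ))) ≤ 1 / 2 →
        ∀ (p p' : ℝ), p.HolderConjugate p' → ∀ (C : ℝ), 0 ≤ C →
          (∀ Φ : ↥(Box d ℓ k M) × ι → ℝ,
            lpM p' ((gk d ℓ k a m2 M ⊗ₖ (1 : Matrix ι ι ℝ)) *ᵥ Φ) ≤ C * lpM 1 Φ) →
          (∀ (μ : Fin (d + 1)) (Φ : ↥(Box d ℓ k M) × ι → ℝ),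
            lpM p' ((dk d ℓ k M μ ⊗ₖ (1 : Matrix ι ι ℝ)) *ᵥ ((gk d ℓ k a m2 M ⊗ₖ (1 : Matrix ι ι ℝ)) *ᵥ Φ))
              ≤ C * lpM 1 Φ) →
        ∀ f : ↥(Box d ℓ k M) × ι → ℝ,
          (∀ μ : Fin (d + 1),
            supN ((greenA d F κ ℓ k a m2 M emb Γ (constBond A₀ Subtype.val + A')
                * (derivA0 d F κ ℓ k M A₀ μ)ᵀ) *ᵥ f) ≤ 2 * C * lpM p f) ∧
          ∀ μ : Fin (d + 1),
            supN ((greenA d F κ ℓ k a m2 M emb Γ (constBond A₀ Subtype.val + A')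
                * (derivA d F κ ℓ k M (constBond A₀ Subtype.val + A') μ)ᵀ) *ᵥ f)
              ≤ (1 + ℓ₁ * θ) * (2 * C) * lpM p f := by
  obtain ⟨c, hc, h⟩ := lemma22_17_pq_box F hℓ₁ hLip κ d ℓ hℓ amin aplus m2plus ha
  refine ⟨c, hc, ?_⟩
  intro k hk a m2 e1' e2 e3 e4 M hM emb Γ hend A₀ A' θ θ' τ hunit hθ hA' hθ' hder hbd hτ0 hτ hsm p p' hpc C hC
    hN0 hND f
  have key := h k hk a m2 e1' e2 e3 e4 M hM emb Γ hend A₀ A' θ θ' τ hunit hθ hA' hθ' hder hbd hτ0 hτ hsm 1 p'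
    le_rfl hpc.symm.lt.le C hC hN0 hND
  have hGt : (greenA d F κ ℓ k a m2 M emb Γ (constBond A₀ Subtype.val + A'))ᵀ
      = greenA d F κ ℓ k a m2 M emb Γ (constBond A₀ Subtype.val + A') := b4Green_transpose F κ _ _ _ _ _ _ _
  have hC2 : 0 ≤ 2 * C := by positivity
  have hC3 : 0 ≤ (1 + ℓ₁ * θ) * (2 * C) := by
    have := mul_nonneg hℓ₁ hθ
    positivity
  refine ⟨fun μ => ?_, fun μ => ?_⟩
  · have hT : greenA d F κ ℓ k a m2 M emb Γ (constBond A₀ Subtype.val + A') * (derivA0 d F κ ℓ k M A₀ μ)ᵀ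
        = (derivA0 d F κ ℓ k M A₀ μ * greenA d F κ ℓ k a m2 M emb Γ (constBond A₀ Subtype.val + A'))ᵀ := by
      rw [Matrix.transpose_mul, hGt]
    rw [hT]
    refine supN_transpose_le_of_lp hpc hC2 (fun Φ => ?_) f
    rw [← Matrix.mulVec_mulVec, ← lpM_one]
    exact (key Φ).2.1 μ
  · have hT : greenA d F κ ℓ k a m2 M emb Γ (constBond A₀ Subtype.val + A')
        * (derivA d F κ ℓ k M (constBond A₀ Subtype.val + A') μ)ᵀ
        = (derivA d F κ ℓ k M (constBond A₀ Subtype.val + A') μ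
            * greenA d F κ ℓ k a m2 M emb Γ (constBond A₀ Subtype.val + A'))ᵀ := by
      rw [Matrix.transpose_mul, hGt]
    rw [hT]
    refine supN_transpose_le_of_lp hpc hC3 (fun Φ => ?_) f
    rw [← Matrix.mulVec_mulVec, ← lpM_one]
    exact (key Φ).2.2 μ

/-- **THIRD MEMBER, `L¹ → L^∞` — REDUCED TO THE ZERO-FIELD BOUND `L¹ → L^∞`**: IF `‖(G_k(□)⊗1)Φ‖_∞ ≤ C‖Φ‖₁` and
`‖(D^η_μ⊗1)(G_k(□)⊗1)Φ‖_∞ ≤ C‖Φ‖₁`, THEN `‖G(D^η_{A₀,μ})ᵀf‖_∞ ≤ 2C‖f‖₁` and `‖G(D^η_{Ã,μ})ᵀf‖_∞ ≤ (1+ℓθ)2C‖f‖₁`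
(member 2 at `(1,∞)` by `lemma22_17_psup_box`, then `supN_transpose_le_of_sup`).
[cite: Balaban1983RegularityDecay, Lemma 2.2 (2.17) p. 578; p. 581; p. 583] -/
theorem lemma22_17_pq_box_dual_one_sup (F : OrthFlow ι) {ℓ₁ : ℝ} (hℓ₁ : 0 ≤ ℓ₁)
    (hLip : ∀ t (v : ι → ℝ), ((F.U t - 1) *ᵥ v) ⬝ᵥ ((F.U t - 1) *ᵥ v) ≤ (ℓ₁ * t) ^ 2 * (v ⬝ᵥ v))
    (κ : ℝ) (d ℓ : ℕ) (hℓ : 1 ≤ ℓ) (amin aplus m2plus : ℝ) (ha : 0 < amin) :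
    ∃ c : ℝ, 0 < c ∧ ∀ (k : ℕ), 1 ≤ k → ∀ (a m2 : ℝ), amin ≤ a → a ≤ aplus → 0 ≤ m2 → m2 ≤ m2plus →
      ∀ (M : Fin (d + 1) → ℕ), (∀ i, 1 ≤ M i) →
      ∀ (emb : ↥(boxDom M) → ↥(Box d ℓ k M)) (Γ : ↥(boxDom M) → ↥(Box d ℓ k M) → List ↥(Box d ℓ k M)),
        (∀ y x, blkWt ((ℓ + 1) ^ k) M (fun i => (ℓ + 1) ^ k * M i) y x ≠ 0 → pathEnd (emb y) (Γ y x) = x) →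
      ∀ (A₀ : Fin (d + 1) → ℝ) (A' : ↥(Box d ℓ k M) → ↥(Box d ℓ k M) → ℝ) (θ θ' τ : ℝ),
        IsUnit (opA d F κ ℓ k a m2 M emb Γ (constBond A₀ Subtype.val + A')).det →
        0 ≤ θ → (∀ x y : ↥(Box d ℓ k M), y.1 ∈ nbrs x.1 → |κ * A' x y| ≤ θ / ((ℓ + 1) ^ k : ℕ)) →
        0 ≤ θ' → (∀ (x z y : ↥(Box d ℓ k M)) (μ : Fin (d + 1)), z.1 = x.1 + e1 μ → y.1 = z.1 + e1 μ →
          |κ * (A' y z - A' z x)| ≤ θ' / (((ℓ + 1) ^ k : ℕ) : ℝ) ^ 2 ∧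
          |κ * (A' x z - A' z y)| ≤ θ' / (((ℓ + 1) ^ k : ℕ) : ℝ) ^ 2) →
        (∀ (x y : ↥(Box d ℓ k M)) (μ : Fin (d + 1)), y.1 = x.1 + e1 μ →
          (x.1 - e1 μ ∉ Box d ℓ k M ∨ y.1 + e1 μ ∉ Box d ℓ k M) → A' x y = 0 ∧ A' y x = 0) →
        0 ≤ τ → (∀ y x, blkWt ((ℓ + 1) ^ k) M (fun i => (ℓ + 1) ^ k * M i) y x ≠ 0 →
          |κ * lsum A' (emb y) (Γ y x)| ≤ τ) →
        ((d : ℝ) + 2) * c * (((d : ℝ) + 1) * ℓ₁ * (θ + θ') + ((d : ℝ) + 1) * ℓ₁ * θ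
          + ((d : ℝ) + 1) * ℓ₁ ^ 2 * θ ^ 2 + B1.aSeq a ((ℓ : ℝ) + 1) k * (ℓ₁ * τ * (2 + ℓ₁ * τ))) ≤ 1 / 2 →
        ∀ (C : ℝ), 0 ≤ C →
          (∀ Φ : ↥(Box d ℓ k M) × ι → ℝ, supN ((gk d ℓ k a m2 M ⊗ₖ (1 : Matrix ι ι ℝ)) *ᵥ Φ) ≤ C * lpM 1 Φ) →
          (∀ (μ : Fin (d + 1)) (Φ : ↥(Box d ℓ k M) × ι → ℝ),
            supN ((dk d ℓ k M μ ⊗ₖ (1 : Matrix ι ι ℝ)) *ᵥ ((gk d ℓ k a m2 M ⊗ₖ (1 : Matrix ι ι ℝ)) *ᵥ Φ))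
              ≤ C * lpM 1 Φ) →
        ∀ f : ↥(Box d ℓ k M) × ι → ℝ,
          (∀ μ : Fin (d + 1),
            supN ((greenA d F κ ℓ k a m2 M emb Γ (constBond A₀ Subtype.val + A')
                * (derivA0 d F κ ℓ k M A₀ μ)ᵀ) *ᵥ f) ≤ 2 * C * l1N f) ∧
          ∀ μ : Fin (d + 1),
            supN ((greenA d F κ ℓ k a m2 M emb Γ (constBond A₀ Subtype.val + A')
                * (derivA d F κ ℓ k M (constBond A₀ Subtype.val + A') μ)ᵀ) *ᵥ f)
              ≤ (1 + ℓ₁ * θ) * (2 * C) * l1N f := by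
  obtain ⟨c, hc, h⟩ := lemma22_17_psup_box F hℓ₁ hLip κ d ℓ hℓ amin aplus m2plus ha
  refine ⟨c, hc, ?_⟩
  intro k hk a m2 e1' e2 e3 e4 M hM emb Γ hend A₀ A' θ θ' τ hunit hθ hA' hθ' hder hbd hτ0 hτ hsm C hC hN0 hND f
  have key := h k hk a m2 e1' e2 e3 e4 M hM emb Γ hend A₀ A' θ θ' τ hunit hθ hA' hθ' hder hbd hτ0 hτ hsm 1 le_rfl
    C hC hN0 hND
  have hGt : (greenA d F κ ℓ k a m2 M emb Γ (constBond A₀ Subtype.val + A'))ᵀ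
      = greenA d F κ ℓ k a m2 M emb Γ (constBond A₀ Subtype.val + A') := b4Green_transpose F κ _ _ _ _ _ _ _
  have hC2 : 0 ≤ 2 * C := by positivity
  have hC3 : 0 ≤ (1 + ℓ₁ * θ) * (2 * C) := by
    have := mul_nonneg hℓ₁ hθ
    positivity
  refine ⟨fun μ => ?_, fun μ => ?_⟩
  · have hT : greenA d F κ ℓ k a m2 M emb Γ (constBond A₀ Subtype.val + A') * (derivA0 d F κ ℓ k M A₀ μ)ᵀ
        = (derivA0 d F κ ℓ k M A₀ μ * greenA d F κ ℓ k a m2 M emb Γ (constBond A₀ Subtype.val + A'))ᵀ := by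
      rw [Matrix.transpose_mul, hGt]
    rw [hT]
    refine supN_transpose_le_of_sup hC2 (fun Φ => ?_) f
    rw [← Matrix.mulVec_mulVec, ← lpM_one]
    exact (key Φ).2.1 μ
  · have hT : greenA d F κ ℓ k a m2 M emb Γ (constBond A₀ Subtype.val + A')
        * (derivA d F κ ℓ k M (constBond A₀ Subtype.val + A') μ)ᵀ
        = (derivA d F κ ℓ k M (constBond A₀ Subtype.val + A') μ
            * greenA d F κ ℓ k a m2 M emb Γ (constBond A₀ Subtype.val + A'))ᵀ := by
      rw [Matrix.transpose_mul, hGt]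
    rw [hT]
    refine supN_transpose_le_of_sup hC3 (fun Φ => ?_) f
    rw [← Matrix.mulVec_mulVec, ← lpM_one]
    exact (key Φ).2.2 μ

end Dual

/-! ## §5 THE STAIRCASE SPECIALISATION (INVERTIBILITY AND CONTOUR HYPOTHESES DISCHARGED) -/

section Stair

variable {d : ℕ}

/-- **(2.17) `L^p → L^q` (MEMBERS `G`, `D^η_μG`, BOTH CONVENTIONS) FOR `G_k(□,Ã)` ON A FINE BOX WITH THE STAIRCASE
CONTOURS, REDUCED TO THE ZERO-FIELD PAIR BOUND — OPERATOR-SIDE HYPOTHESES DISCHARGED** exactly as in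
`B4Lemma22LpStair.lemma22_17_lp_stair` (invertibility from `B4Lower18Regular.green_box_l2_bound` under
`ℓ²θ²(d+1)(1 + a_k(d+1)) ≤ min(2,a_k)/4`, contour ends from `stairContour_end`, `τ = (d+1)θ` from
`B4Lemma22SupStair.stair_lsum_le`): for all real `p, q ≥ 1`, `C ≥ 0`, IF `‖(G_k(□)⊗1)Φ‖_q ≤ C‖Φ‖_p` and
`‖(D^η_μ⊗1)(G_k(□)⊗1)Φ‖_q ≤ C‖Φ‖_p` THEN `‖Gf‖_q ≤ 2C‖f‖_p`, `‖D^η_{A₀,μ}Gf‖_q ≤ 2C‖f‖_p`,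
`‖D^η_{Ã,μ}Gf‖_q ≤ (1+ℓθ)2C‖f‖_p`.  (The target `‖·‖_∞` and the third member specialise in the same way from
`lemma22_17_psup_box` / `lemma22_17_pq_box_dual*`.)
[cite: Balaban1983RegularityDecay, Lemma 2.2 (2.17) p. 578; proof pp. 579–583] -/
theorem lemma22_17_pq_stair (F : OrthFlow ι) {ℓ₁ : ℝ} (hℓ₁ : 0 ≤ ℓ₁)
    (hLip : ∀ t (v : ι → ℝ), ((F.U t - 1) *ᵥ v) ⬝ᵥ ((F.U t - 1) *ᵥ v) ≤ (ℓ₁ * t) ^ 2 * (v ⬝ᵥ v))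
    (κ : ℝ) (d ℓ : ℕ) (hℓ : 1 ≤ ℓ) (amin aplus m2plus : ℝ) (ha : 0 < amin) :
    ∃ c : ℝ, 0 < c ∧ ∀ (k : ℕ), 1 ≤ k → ∀ (hn : 1 ≤ (ℓ + 1) ^ k) (a m2 : ℝ),
      amin ≤ a → a ≤ aplus → 0 ≤ m2 → m2 ≤ m2plus →
      ∀ (M : Fin (d + 1) → ℕ), (∀ i, 1 ≤ M i) →
      ∀ (A₀ : Fin (d + 1) → ℝ) (A' : ↥(Box d ℓ k M) → ↥(Box d ℓ k M) → ℝ) (θ θ' : ℝ),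
        0 ≤ θ → (∀ x y : ↥(Box d ℓ k M), y.1 ∈ nbrs x.1 → |κ * A' x y| ≤ θ / ((ℓ + 1) ^ k : ℕ)) →
        0 ≤ θ' → (∀ (x z y : ↥(Box d ℓ k M)) (μ : Fin (d + 1)), z.1 = x.1 + e1 μ → y.1 = z.1 + e1 μ →
          |κ * (A' y z - A' z x)| ≤ θ' / (((ℓ + 1) ^ k : ℕ) : ℝ) ^ 2 ∧
          |κ * (A' x z - A' z y)| ≤ θ' / (((ℓ + 1) ^ k : ℕ) : ℝ) ^ 2) →
        (∀ (x y : ↥(Box d ℓ k M)) (μ : Fin (d + 1)), y.1 = x.1 + e1 μ →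
          (x.1 - e1 μ ∉ Box d ℓ k M ∨ y.1 + e1 μ ∉ Box d ℓ k M) → A' x y = 0 ∧ A' y x = 0) →
        ℓ₁ ^ 2 * θ ^ 2 * ((d : ℝ) + 1) * (1 + B1.aSeq a ((ℓ : ℝ) + 1) k * ((d : ℝ) + 1))
          ≤ min 2 (B1.aSeq a ((ℓ : ℝ) + 1) k) / 4 →
        ((d : ℝ) + 2) * c * (((d : ℝ) + 1) * ℓ₁ * (θ + θ') + ((d : ℝ) + 1) * ℓ₁ * θ
          + ((d : ℝ) + 1) * ℓ₁ ^ 2 * θ ^ 2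
          + B1.aSeq a ((ℓ : ℝ) + 1) k * (ℓ₁ * (((d : ℝ) + 1) * θ) * (2 + ℓ₁ * (((d : ℝ) + 1) * θ)))) ≤ 1 / 2 →
        ∀ (p q : ℝ), 1 ≤ p → 1 ≤ q → ∀ (C : ℝ), 0 ≤ C →
          (∀ Φ : ↥(Box d ℓ k M) × ι → ℝ, lpM q ((gk d ℓ k a m2 M ⊗ₖ (1 : Matrix ι ι ℝ)) *ᵥ Φ) ≤ C * lpM p Φ) →
          (∀ (μ : Fin (d + 1)) (Φ : ↥(Box d ℓ k M) × ι → ℝ),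
            lpM q ((dk d ℓ k M μ ⊗ₖ (1 : Matrix ι ι ℝ)) *ᵥ ((gk d ℓ k a m2 M ⊗ₖ (1 : Matrix ι ι ℝ)) *ᵥ Φ))
              ≤ C * lpM p Φ) →
        ∀ f : ↥(Box d ℓ k M) × ι → ℝ,
          lpM q (greenA d F κ ℓ k a m2 M (baseEmb hn M) (stairContour hn M) (constBond A₀ Subtype.val + A') *ᵥ f)
              ≤ 2 * C * lpM p f ∧
          (∀ μ : Fin (d + 1),
            lpM q (derivA0 d F κ ℓ k M A₀ μ
                *ᵥ (greenA d F κ ℓ k a m2 M (baseEmb hn M) (stairContour hn M) (constBond A₀ Subtype.val + A')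
                    *ᵥ f)) ≤ 2 * C * lpM p f) ∧
          ∀ μ : Fin (d + 1),
            lpM q (derivA d F κ ℓ k M (constBond A₀ Subtype.val + A') μ
                *ᵥ (greenA d F κ ℓ k a m2 M (baseEmb hn M) (stairContour hn M) (constBond A₀ Subtype.val + A')
                    *ᵥ f))
              ≤ (1 + ℓ₁ * θ) * (2 * C) * lpM p f := by
  obtain ⟨c, hc, h⟩ := lemma22_17_pq_box F hℓ₁ hLip κ d ℓ hℓ amin aplus m2plus ha
  refine ⟨c, hc, ?_⟩
  intro k hk hn a m2 e1' e2 e3 e4 M hM A₀ A' θ θ' hθ hA' hθ' hder hbd hsm2 hsm p q hp hq C hC hN0 hND f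
  have hL : (1 : ℝ) < (ℓ : ℝ) + 1 := by
    have : (1 : ℝ) ≤ ℓ := by exact_mod_cast hℓ
    linarith
  have hak : 0 < B1.aSeq a ((ℓ : ℝ) + 1) k := B1.aSeq_pos (lt_of_lt_of_le ha e1') hL hk
  have hpos : 0 < min 2 (B1.aSeq a ((ℓ : ℝ) + 1) k) / 4 + m2 := by
    have : 0 < min 2 (B1.aSeq a ((ℓ : ℝ) + 1) k) := lt_min two_pos hak
    linarith
  have hAd : ∀ x y : ↥(Box d ℓ k M), y.1 ∈ nbrs x.1 →
      |κ * ((constBond A₀ Subtype.val + A' : ↥(Box d ℓ k M) → ↥(Box d ℓ k M) → ℝ) x y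
        - constBond A₀ Subtype.val x y)| ≤ θ / ((ℓ + 1) ^ k : ℕ) := by
    intro x y hxy
    simpa only [Pi.add_apply, add_sub_cancel_left] using hA' x y hxy
  have hunit := (green_box_l2_bound F hℓ₁ hLip κ hn hak.le hpos M A₀ (A := constBond A₀ Subtype.val + A') hθ hAd
    hsm2 0).1
  have hτ : ∀ y x, blkWt ((ℓ + 1) ^ k) M (fun i => (ℓ + 1) ^ k * M i) y x ≠ 0 →
      |κ * lsum A' (baseEmb hn M y) (stairContour hn M y x)| ≤ ((d : ℝ) + 1) * θ :=
    fun y x _ => stair_lsum_le κ hn M hθ hA' y x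
  have hτ0 : 0 ≤ ((d : ℝ) + 1) * θ := by positivity
  exact h k hk a m2 e1' e2 e3 e4 M hM (baseEmb hn M) (stairContour hn M) (fun y x hw => stairContour_end hn M y x hw)
    A₀ A' θ θ' (((d : ℝ) + 1) * θ) hunit hθ hA' hθ' hder hbd hτ0 hτ hsm p q hp hq C hC hN0 hND f

end Stair

/-! ## §6 The dictionary to the b04 carrier functional `RegularCubeInstance.lpN` (`η`-weighted, exponent `1/s`) -/

section Dictionary

variable {d : ℕ}

omit [DecidableEq ι] in
/-- **`lpN s f = (η^{d+1})^s‖f‖_{1/s}`** for `s ≠ 0` (`η = n⁻¹`): the carrier's `η`-weighted functional with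
reciprocal exponent is a positive multiple of the mixed norm of this lineage. [folklore] -/
theorem lpN_eq_mul_lpM (i : RegularCubeInstance d) {s : ℝ} (hs : s ≠ 0)
    (f : ↥(fineDom i.n i.Ωc) × ι → ℝ) :
    i.lpN s f = (((i.n : ℝ)⁻¹) ^ (d + 1)) ^ s * lpM (1 / s) f := by
  unfold RegularCubeInstance.lpN lpM lpS
  rw [if_neg hs, one_div, inv_inv,
    Real.mul_rpow (pow_nonneg (inv_nonneg.2 (Nat.cast_nonneg _)) _)
      (sum_nonneg fun x _ => Real.rpow_nonneg (siteNorm_nonneg _) _)]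
  congr 2
  exact sum_congr rfl fun x _ => by rw [abs_of_nonneg (siteNorm_nonneg _)]

omit [DecidableEq ι] in
/-- **`lpN 0 f = ‖f‖_∞`** (`B4Lemma22Reduce231.supN`). [folklore] -/
theorem lpN_zero_eq_supN (i : RegularCubeInstance d) (f : ↥(fineDom i.n i.Ωc) × ι → ℝ) :
    i.lpN 0 f = supN f := by
  unfold RegularCubeInstance.lpN supN
  rw [if_pos rfl]

end Dictionary

end

end Literature.MathematicalPhysics.QuantumFieldTheory.Balaban1983to89.B4Lemma22LpLqTransfer
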